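import Literature.MathematicalPhysics.QuantumFieldTheory.Balaban1983to89.B5Hk163Decay
import Literature.MathematicalPhysics.QuantumFieldTheory.Balaban1983to89.T4Rate166StripDirect

/-!
# `Balaban1983to89.T4Hk163StripRate` — the η-RATE of the (1.63) multipliers of `H_k` on the COMPLEX ZERO-FREE STRIP at the full rate `η¹`, and the exponentially-decaying η-rate of their lattice / torus kernels (cell lane t4-ne2, seat P2 "strip/contour", generation 5; spine estimate NE2 (U1a), node X10; GAPS G-ne2p2-6)

HONEST FRAMING (page 1).  Rung (B)+1 bookkeeping for the LINEAR (Gaussian) theory on FINITE tori / the unit lattice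
`ℤ^{d+1}`, gauge group U(1), background field switched OFF (`U = 1`), `m² = 0`, general dimension.  This is NOT an
infinite-volume statement about the model, NOT a mass-gap statement, NOT a statement about the Clay problem and NOT
summit progress: it is a kernel certificate for ONE input of the cell's spine estimate NE2 — the rate, in the lattice
spacing `η = 1/n`, at which the coarse multipliers `G_a^{(n)}` of the (1.63) operator (b05 lineage, `B5Hk163Decay.G163`)
converge on the complex strip, and hence the rate of their position-space kernels WITH exponential decay.  Conditional on
nothing: no `BetaPertH`, no hypothesis (B)/(B^μ) enters (the statements are about explicit trigonometric rational
functions); every declaration is `[folklore]` audit mathematics proved here from tree modules BY NAME.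

SOURCES (locations of printed TEXT only; nothing printed is used as a hypothesis — ABSOLUTE RULE).
* T. Bałaban, *Propagators and renormalization transformations for lattice gauge theories. I*, Commun. Math. Phys. **95**
  (1984) 17–40 [`Balaban1984PropagatorsI`, cell paper B5; held text `paper:balaban1984-cmp95-propagators-rt-i`]: (1.63)
  p. 28 [PDF 12] (the second expression for `(H_kB)~_μ(p′+l)`, typed as `B5Symbol163.second163`, regrouped on the
  strip as `Σ_λ h163 μ λ l (p′) B̃_λ`, `B5Hk163Strip.second163_eq_sum_h163`); p. 38 [PDF 22, l. 9–11], the METHOD,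
  verbatim: «They follow from the representation P = G′Q′*(Q′G′²Q′*)⁻¹Q′G′, from Lemma 2.4 of [2], and the
  representation (1.45) and the analyticity method of proving an exponential decay (see the proof of Lemma 2.4 in
  [2]).»  B5 prints NO display asserting an `η`-rate of the kernel of (1.63); what is proved below is an AUDIT
  CONSTRUCTION in the style of the p. 38 analyticity method.
* C. King, *The U(1) Higgs model. I*, Commun. Math. Phys. **102** (1986) 649–677 [`King1986`], §4 pp. 672–673: the
  MECHANISM, verbatim p. 672 (page render `1986-cmp102-king-u1-higgs-I-p024-x2.png`, read as an image by this unit):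
  «To analyze the m = 0 term in (4.19), we successively replace each factor by the corresponding one in the expression
  for (∂_α(x, y)∂^η_μ a_kG^η_kQ^*_k)(z) and bound the error. We must always be careful to keep enough negative powers of
  momentum so that» [p. 673:] «the sum over l is bounded.» — this is what the bookkeeping `RB` packages of §3 implement,
  here with ABSOLUTE rates on the complex strip and the alias PAIRING `ι` of `T4Rate166StripDirect` (gen 4).  King's text
  concerns the scalar `a_kG_kQ_k^*`; nothing in King concerns Bałaban's `H_k`.

## The objects (all from the tree, imported by name)

Level `n` (fine lattice `ηℤ^d`, `η = 1/n`, over the unit lattice), complex fibre momentum `p′ ∈ Strip d κ`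
(`|Im p′_ν| ≤ κ ≤ κ₁₆₃(d)`, the zero-free strip of `B5Hk163Strip` §4), aliases `l = 2πk`, `k ∈ (Fin n)^d`:
`h163 n μ λ k p′` (`B5Hk163Strip`), the fine-offset phase `phase163 n k a p′` and the coarse multiplier
`G163 n μ λ a p′ = Σ_k phase163·h163` (`B5Hk163Decay`), the pairing `ι = iotaK n m` of level-`n` aliases with level-`m`
aliases and the recentred shifted Laplacian `SW` (`T4Rate166StripDirect`), the alias weights `ω_n(j)`, `W_n(k) = Σ_ν ω_n(k_ν)²`
(`B4StripSums`).  Two fine offsets `a ∈ (Fin n)^d`, `a′ ∈ (Fin m)^d` are at the SAME PHYSICAL POSITION when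
`a′_ν·n = a_ν·m` for all `ν` (hypothesis `hphys`; King's shape: `m = nL^j`, `a′ = a·L^j`).

## What is proved (sorry-free; constants ours, crude, `d`-only)

* §1 the leaves in the recentred variable `wc`: `v̄C_μ(p′+ι l) ` and `v̄C_μ(p′+l)` are the SAME entire function `gm` of
  `wc` at the two spacings (`vCbar_iotaK_eq_gm`, `vCbar_eq_gm`), whence the ABSOLUTE rates `vCbar_RB`
  (`‖v̄C^{(m)}_μ(ιl) − v̄C^{(n)}_μ(l)‖ ≤ Cv/n`, bound `12/ω_n(l_μ)`) and `dC_mul_vCbar_RB` (`∂_μ v̄C_μ`: bound 4, rate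
  `Cp·ω_n(l_μ)/n`); `phase163_iotaK_eq`: paired aliases at the same physical offset carry the SAME phase.
* §2 the summable alias profile `prof_n(k) = (Π_ν 12/ω_n(k_ν))·W_n(k)^{−1/2}`: `sum_prof_le` (`Σ_k prof_n(k) ≤ Cprof(d)`,
  uniformly in `n`, via `B4StripSums.sum_omega_rpow_le`), and the UNPAIRED GAIN `inv_W_unpaired_le`
  (`W_m(K)⁻¹ ≤ (2/n)·W_m(K)^{−1/2}` at an unpaired level-`m` alias).
* §3 King-style bookkeeping with the `RB` packages of gen 4: closed form of the inner alias sum `Σ_{l′≠l} A_{l,l′}`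
  through `R̃`, `X_{≠0}`, `T(l)` (`sum_Afac_eq`, `sum_Afac_eq'`, `sum_Afac_zero_eq`); packages of `SW⁻¹`, `ρ_l`, `T(l)`,
  `U_l/Δ_l²`, `X_{≠0}` (`Xne_rate`: `‖X^{(m)} − X^{(n)}‖ ≤ KX/n²`), `𝒩` (`Ncal_RB`), the inner sum (`SA_RB`: bound
  `BS·t(t+s)`, rate `KS·n⁻²(t+s)`, `t = W_n(l)⁻¹`, `s = ω_n(l_μ)⁻²`), the two-currency normal form `RB_nmul`/`RB_ndiv`,
  the head / tail numerators and the chain `h163_RB_of`; the results `h163_RB` (paired alias `l ≠ 0`: bound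
  `Bh·Pom·W⁻¹`, rate `Kh·n⁻¹·prof`), `h163_zero_RB`, **`h163_rate_ne`**, **`h163_rate_zero`**, and the level-uniform
  profile bound `norm_h163_le_W` (`‖h^{(N)}_{l;μλ}‖ ≤ Bh·Pom_N(l)·W_N(l)⁻¹`, `N ≥ 2`, `l ≠ 0`).
* §4 **`G163_rate`**: for `1 ≤ n ≤ m`, `0 ≤ κ ≤ κ₁₆₃(d)`, `p′ ∈ Strip d κ`, every `μ, λ` and fine offsets at the same
  physical position, `‖G_{a′}^{(m)}(p′) − G_a^{(n)}(p′)‖ ≤ (e^κ)^d·CG(d)/n` (paired aliases by §3, unpaired ones by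
  `norm_h163_le_W` and the unpaired gain, the zero alias separately; `n = 1` by `B5Hk163Decay.norm_G163_le`).
* §5 position space on `ℂ^{d+1}`: `stripRegular_G163_sub` (the level difference is `B4ContourShift.StripRegular` on
  `Strip (d+1) κ` with bound THE RATE `CGe(d+1)/n`), hence BY NAME of the b04 engines `latticeKernel_G163_rate`
  (`‖K_{a′}^{(m)}(x) − K_a^{(n)}(x)‖ ≤ CGe(d+1)/n · e^{−κ₁₆₃(d+1)|x|_∞}` on `ℤ^{d+1}`, `B4ContourShift.latticeKernel_decay`,
  `B4Green242Bridge.latticeKernel_sub`) and `torusKernel_G163_rate` (every period vector, uniformly in the volume: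
  `≤ CGe(d+1)/n · periodConst · e^{−(κ₁₆₃(d+1)/(d+1))|x|_{T,∞}}`, `B4TorusKernel.MultiPeriod.torusKernel_descend_decay_torusMetric`,
  `T4GaugeActionRateStrip.torusKernel_descendC_sub`), with King's shape `n = L^k`, `m = L^{k+j}` (amplitude `CGe·L^{−k}`).

## Relation to the sibling modules (delta)

`B5Hk163Rate` / `B5Hk163RateSum` / `B5Hk163RatePosition` (seat P1) prove RELATIVE rates `N^{−γ}`, `γ < 1`, at REAL
fine-zone momenta and position-space sup / Hölder rates WITHOUT spatial decay; `B5Hk163Decay` (b05) proves the uniform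
strip bound and the kernel DECAY with no rate; `T4Rate166StripDirect` (gen 4 of this seat) proves the strip rate `n⁻²` of
the (1.66) entry symbol.  This module: the (1.63) multipliers on the COMPLEX strip at the rate `η¹ = 1/n` (the `v̄`-leaves
carry the half-spacing phases `e^{−iη(p′+l)_μ/2}`, whose own rate is `O(η)`; no optimality is claimed), and the
position-space rate WITH the exponential decay `e^{−κ₁₆₃|x|}` — the combination the contour-shift engine of b04 delivers.

## v1.1 (unit `b2b-balaban-t4-ne2-p2-g6`) — DOCSTRING-ONLY build note

No declaration, statement, proof, name or import changed with respect to v1 (p186792, commit 204ee92bc9c6): this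
re-issue only records, for consumers, that the module is imported BY NAME by `T4Hk163RatePair` (the
`T4RateAlgebra.RatePair … (L⁻¹)` reading of §4 for the zone centre, gen 5) and by the (1.83) sequel `T4G183StripRate`
(gen 6, the covariant regular part of Bałaban's (1.83) on the same strip), which reuse §1–§3 (`gm`, `vCbar_RB`,
`dC_mul_vCbar_RB`, `prof`/`sum_prof_le`, `inv_W_unpaired_le`, the `RB` normal forms) verbatim by name.  Nothing printed is
quoted anew; the honest framing above is unchanged (U = 1 linear theory, finite tori, rung (B)+1; not a mass-gap statement).

## v1.2 (unit `b2b-balaban-t4-ne2-p2-g6`) — BUILD-ROBUSTNESS ONLY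

No declaration, statement, name or import changed with respect to v1.1 (p193033, commit 7250638a6e92) and no proof
TEXT changed: the only edit is `set_option maxHeartbeats 800000 in` on the two heaviest declarations `headNum_RB` and
`tailNum_RB` (§3), whose closing `nlinarith` calls run close to the default budget — under `lake build` the v1.1 module
stopped at `tailNum_RB` (1702:4, «maximum number of heartbeats (200000)», gate4 BUILD-BROKEN-2026-08-19 row 1) although
the farm check had passed; a halved-budget probe (`maxHeartbeats 100000`) flags exactly these two declarations and no
other.  Honest framing unchanged (U = 1 linear theory, finite tori, rung (B)+1; not a mass-gap statement).

## Honest scope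

(i) As in `B5Hk163Decay`, the identification of `latticeKernel (G163 n μ λ a) (y′ − y)` (resp. the torus kernel) with
«the kernel of `H_k` between the fine point `y′ + ηa` and the coarse point `y`» for a TYPED lattice operator `H_k` is
Fourier-inversion bookkeeping left to the consumer that types `H_k` (`B5Hk163Decay.exp_fine_phase_split` is the
dictionary).  (ii) `U = 1` throughout: the background-field layer ((1.83)–(1.84), X9) is not touched.  (iii) Constants
(`CG`, `CGe`, `Kh`, …) are explicit but astronomically crude and `d`-only — never Bałaban's `O(1)`; the width is the b05
width `κ₁₆₃`.  (iv) Nothing here is a statement about `a_k`, the effective actions, or any non-linear step.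
-/

namespace Literature.MathematicalPhysics.QuantumFieldTheory.Balaban1983to89.T4Hk163StripRate

open scoped BigOperators
open Finset Complex
open Literature.MathematicalPhysics.QuantumFieldTheory.Balaban1983to89.B4Strip
open Literature.MathematicalPhysics.QuantumFieldTheory.Balaban1983to89.B4StripCauchy
open Literature.MathematicalPhysics.QuantumFieldTheory.Balaban1983to89.B4StripSums
  (w v omega omega_pos one_le_omega omega_zero omega_le_left omega_le_right W W_nonneg one_le_W omega_sq_le_W
    norm_v_le norm_sq_exp_sub_one Sxi_eq_sq_mul_S1 zetaC zetaC_nonneg sum_omega_rpow_le inv_W_le_prod_rpow)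
open Literature.MathematicalPhysics.QuantumFieldTheory.Balaban1983to89.B5Symbol166
open Literature.MathematicalPhysics.QuantumFieldTheory.Balaban1983to89.B5Symbol166Strip
open Literature.MathematicalPhysics.QuantumFieldTheory.Balaban1983to89.B5Strip145 (Ncal Xne)
open Literature.MathematicalPhysics.QuantumFieldTheory.Balaban1983to89.B5Hk163Strip
  (vCbar uCbar dC Tfac Afac headC tailC gdir h163 kappa163 kappa163_pos kappa163_le_rOf denominators_lower
    dC_mul_vCbar norm_dC_mul_vCbar_le norm_gdir_le Mg163 cY163 cN163 cF163 cY163_pos cN163_pos cF163_pos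
    kappa163_le_kappaY Yc_lower norm_div_le_of)
open Literature.MathematicalPhysics.QuantumFieldTheory.Balaban1983to89.B5Hk163Alias
  (vCbar_eq_v exp_shift_eq_inv_w norm_vCbar_le_omega norm_uCbar_le_prod norm_dC_mul_uCbar_le_prod
    norm_rho_le_W inv_norm_DeltaXi_shift_le)
open Literature.MathematicalPhysics.QuantumFieldTheory.Balaban1983to89.B5Hk163Decay
  (phase163 G163 norm_phase163_le G163_tr norm_G163_le differentiableAt_G163 MG163 stripRegular_G163)
open Literature.MathematicalPhysics.QuantumFieldTheory.Balaban1983to89.T4Rate166StripDirect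
  hiding rho rho_nonneg

noncomputable section

variable {d : ℕ}

/-! ## §1 The leaves in the recentred variable and their absolute `η`-rates -/

/-- `e^{−i(u + 2πN)/N} = e^{−iu/N}`. [folklore] -/
theorem exp_neg_I_div_add_period (N : ℕ) (hN : N ≠ 0) (u : ℂ) :
    cexp (-(I * (u + 2 * Real.pi * (N : ℂ)) / N)) = cexp (-(I * u / N)) := by
  have hN' : (N : ℂ) ≠ 0 := Nat.cast_ne_zero.mpr hN
  rw [show -(I * (u + 2 * Real.pi * (N : ℂ)) / N) = -(I * u / N) + -(2 * Real.pi * I) by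
    field_simp; ring]
  rw [Complex.exp_add, Complex.exp_neg (2 * Real.pi * I), Complex.exp_two_pi_mul_I, inv_one, mul_one]

/-- `w_n(j; z) = e^{−i·wc_n(j;z)/n}`. [folklore] -/
theorem w_eq_exp_wc (n j : ℕ) (hn : n ≠ 0) (z : ℂ) : w n j z = cexp (-(I * wc n j z / n)) := by
  unfold w wc
  split_ifs with h
  · rfl
  · rw [← exp_neg_I_div_add_period n hn (z + 2 * Real.pi * (j : ℂ) - 2 * Real.pi * (n : ℂ))]
    congr 1
    ring

/-- `w_m(ι j; z) = e^{−i·wc_n(j;z)/m}` (`n ≤ m`): the paired alias of the finer level has the SAME recentred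
variable. [folklore] -/
theorem w_iota_eq_exp_wc (n m j : ℕ) (hm : m ≠ 0) (hnm : n ≤ m) (z : ℂ) :
    w m (iota n m j) z = cexp (-(I * wc n j z / m)) := by
  unfold w wc iota
  split_ifs with h
  · rfl
  · rw [← exp_neg_I_div_add_period m hm (z + 2 * Real.pi * (j : ℂ) - 2 * Real.pi * (n : ℂ))]
    congr 1
    push_cast [Nat.cast_sub hnm]
    ring

/-- the fine phase of level `n` in the recentred variable: `e^{iη(p′_μ+l_μ)} = e^{i·wc/n}`. [folklore] -/
theorem exp_shift_eq_exp_wc (n : ℕ) [NeZero n] (k : Fin d → Fin n) (p : Fin d → ℂ) (μ : Fin d) :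
    cexp (shift n k p μ / n * I) = cexp (I * wc n (k μ) (p μ) / n) := by
  rw [exp_shift_eq_inv_w, w_eq_exp_wc n _ (NeZero.ne n), ← Complex.exp_neg, neg_neg]

/-- the fine phase of level `m` at the paired alias: `e^{i(p′_μ+ι(l)_μ)/m} = e^{i·wc/m}`. [folklore] -/
theorem exp_shift_iotaK_eq_exp_wc {n m : ℕ} [NeZero m] (hnm : n ≤ m) (k : Fin d → Fin n) (p : Fin d → ℂ)
    (μ : Fin d) :
    cexp (shift m (iotaK n m hnm k) p μ / m * I) = cexp (I * wc n (k μ) (p μ) / m) := by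
  rw [exp_shift_eq_inv_w, iotaK_val, w_iota_eq_exp_wc n m _ (NeZero.ne m) hnm, ← Complex.exp_neg, neg_neg]

/-- the block mean `g_N(u) = N⁻¹ Σ_{s<N} e^{−ius/N}` of one coordinate, as a function of the recentred variable. [folklore] -/
def gm (N : ℕ) (u : ℂ) : ℂ := (N : ℂ)⁻¹ * ∑ s ∈ Finset.range N, cexp (-(I * u / N)) ^ s

/-- `N·(e^{−iu/N} − 1)`: `N` times the backward unit difference of the fine lattice in the recentred variable. [folklore] -/
def En (N : ℕ) (u : ℂ) : ℂ := (N : ℂ) * (cexp (-(I * u / N)) - 1)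

/-- `v̄C_μ(l; p′) = g_n(wc_n(l_μ; p′_μ))`. [folklore] -/
theorem vCbar_eq_gm (n : ℕ) [NeZero n] (k : Fin d → Fin n) (p : Fin d → ℂ) (μ : Fin d) :
    vCbar n k p μ = gm n (wc n (k μ) (p μ)) := by
  rw [vCbar_eq_v]
  unfold v gm
  rw [w_eq_exp_wc n _ (NeZero.ne n)]

/-- `v̄C_μ(ι l; p′)` of level `m` `= g_m(wc_n(l_μ; p′_μ))`. [folklore] -/
theorem vCbar_iotaK_eq_gm {n m : ℕ} [NeZero m] (hnm : n ≤ m) (k : Fin d → Fin n) (p : Fin d → ℂ) (μ : Fin d) :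
    vCbar m (iotaK n m hnm k) p μ = gm m (wc n (k μ) (p μ)) := by
  rw [vCbar_eq_v, iotaK_val]
  unfold v gm
  rw [w_iota_eq_exp_wc n m _ (NeZero.ne m) hnm]

/-- closed form of the block mean off the zeros of `En`: `g_N(u) = (e^{−iu} − 1)/En_N(u)`. [folklore] -/
theorem gm_eq_quotient (N : ℕ) (hN : N ≠ 0) {u : ℂ} (hE : En N u ≠ 0) :
    gm N u = (cexp (-(I * u)) - 1) / En N u := by
  have hq : cexp (-(I * u / N)) ≠ 1 := by
    intro h; apply hE; unfold En; rw [h, sub_self, mul_zero]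
  have hN' : (N : ℂ) ≠ 0 := Nat.cast_ne_zero.mpr hN
  unfold gm En
  rw [geom_sum_eq hq, ← Complex.exp_nat_mul, show (N : ℂ) * -(I * u / N) = -(I * u) by field_simp]
  field_simp

/-- at `u = 0` the block mean is `1`. [folklore] -/
theorem gm_zero (N : ℕ) (hN : N ≠ 0) : gm N 0 = 1 := by
  have hN' : (N : ℂ) ≠ 0 := Nat.cast_ne_zero.mpr hN
  unfold gm
  simp [hN']

/-- `‖En_N(u)‖² = e^{Im u/N}·‖S_ξ^{(N)}(u)‖`. [folklore] -/
theorem norm_En_sq (N : ℕ) (hN : N ≠ 0) (u : ℂ) :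
    ‖En N u‖ ^ 2 = Real.exp (u.im / N) * ‖Sxi N u‖ := by
  have hN' : (N : ℂ) ≠ 0 := Nat.cast_ne_zero.mpr hN
  have him : (u / (N : ℂ)).im = u.im / N := by
    rw [← Complex.ofReal_natCast, Complex.div_ofReal_im]
  unfold En
  rw [norm_mul, mul_pow, Complex.norm_natCast, show -(I * u / (N : ℂ)) = -(I * (u / N)) by ring,
    norm_sq_exp_sub_one, him, Sxi_eq_sq_mul_S1, norm_mul, norm_pow, Complex.norm_natCast]
  ring

/-- LOWER BOUND of the first-difference symbol on the extended range: `‖En_N(u)‖ ≥ ‖u‖/8` for `2 ≤ N`,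
`|Re u| ≤ πN + π + 1/4`, `|Im u| ≤ 1/2` (from `‖S_ξ^{(N)}(u)‖ ≥ ‖u‖²/32`). [folklore] -/
theorem norm_En_ge (N : ℕ) (hN : 2 ≤ N) {u : ℂ} (hx : |u.re| ≤ Real.pi * N + Real.pi + 1 / 4)
    (hy : |u.im| ≤ 1 / 2) : ‖u‖ / 8 ≤ ‖En N u‖ := by
  have hN0 : N ≠ 0 := by omega
  have hNr : (2 : ℝ) ≤ N := by exact_mod_cast hN
  have hS := norm_Sxi_ge_sq_div N hN hx
  have hsq := norm_En_sq N hN0 u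
  have hy' := abs_le.mp hy
  have him : -(1 / 4 : ℝ) ≤ u.im / N := by
    rw [le_div_iff₀ (by linarith)]; nlinarith
  have hexp : (1 / 2 : ℝ) ≤ Real.exp (u.im / N) := by
    have h1 : Real.exp (-(1 / 4 : ℝ)) ≤ Real.exp (u.im / N) := Real.exp_le_exp.mpr him
    have h2 : (1 / 2 : ℝ) ≤ Real.exp (-(1 / 4 : ℝ)) := by
      rw [Real.exp_neg, le_inv_comm₀ (by norm_num) (Real.exp_pos _)]
      have h3 : Real.exp (1 / 4 : ℝ) ^ 4 = Real.exp 1 := by rw [← Real.exp_nat_mul]; norm_num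
      have h4 := Real.exp_one_lt_d9
      have h5 := Real.exp_pos (1 / 4 : ℝ)
      nlinarith [sq_nonneg (Real.exp (1 / 4 : ℝ)), sq_nonneg (Real.exp (1 / 4 : ℝ) ^ 2 - 2)]
    linarith
  have hlow : ‖u‖ ^ 2 / 64 ≤ ‖En N u‖ ^ 2 := by
    rw [hsq]
    have : ‖u‖ ^ 2 / 64 = 1 / 2 * (‖u‖ ^ 2 / 32) := by ring
    rw [this]
    exact mul_le_mul hexp hS (by positivity) (Real.exp_pos _).le
  nlinarith [norm_nonneg (En N u), norm_nonneg u]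

/-- the Taylor estimate of the first-difference symbol: `‖En_N(u) + iu‖ ≤ ‖u‖² e^{‖u‖/N}/N` (`N ≥ 1`). [folklore] -/
theorem norm_En_add_le (N : ℕ) (hN : N ≠ 0) (u : ℂ) :
    ‖En N u + I * u‖ ≤ ‖u‖ ^ 2 * Real.exp (‖u‖ / N) / N := by
  have hN' : (N : ℂ) ≠ 0 := Nat.cast_ne_zero.mpr hN
  have hNr : (0 : ℝ) < N := by exact_mod_cast Nat.pos_of_ne_zero hN
  set x : ℂ := -(I * u / N) with hx
  have h1 := Complex.norm_exp_sub_sum_le_norm_mul_exp x 2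
  have hs : ∑ m ∈ Finset.range 2, x ^ m / (m.factorial : ℂ) = 1 + x := by
    simp [Finset.sum_range_succ]
  rw [hs] at h1
  have e : En N u + I * u = (N : ℂ) * (cexp x - (1 + x)) := by
    unfold En; rw [hx]; field_simp; ring
  have nx : ‖x‖ = ‖u‖ / N := by
    rw [hx, norm_neg, norm_div, norm_mul, Complex.norm_I, one_mul, Complex.norm_natCast]
  rw [e, norm_mul, Complex.norm_natCast]
  rw [nx] at h1
  calc (N : ℝ) * ‖cexp x - (1 + x)‖ ≤ N * ((‖u‖ / N) ^ 2 * Real.exp (‖u‖ / N)) := by gcongr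
    _ = ‖u‖ ^ 2 * Real.exp (‖u‖ / N) / N := by field_simp

/-- the REFINEMENT RATE of the first-difference symbol: `‖En_m(u) − En_n(u)‖ ≤ 2‖u‖²e^{‖u‖/n}/n` (`1 ≤ n ≤ m`). [folklore] -/
theorem norm_En_sub_En_le {n m : ℕ} (hn : 1 ≤ n) (hnm : n ≤ m) (u : ℂ) :
    ‖En m u - En n u‖ ≤ 2 * ‖u‖ ^ 2 * Real.exp (‖u‖ / n) / n := by
  have hm : 1 ≤ m := hn.trans hnm
  have hnr : (0 : ℝ) < n := by exact_mod_cast (show 0 < n by omega)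
  have hmr : (n : ℝ) ≤ m := by exact_mod_cast hnm
  have h1 := norm_En_add_le m (by omega) u
  have h2 := norm_En_add_le n (by omega) u
  have e : En m u - En n u = (En m u + I * u) - (En n u + I * u) := by ring
  rw [e]
  have hexp : Real.exp (‖u‖ / m) ≤ Real.exp (‖u‖ / n) :=
    Real.exp_le_exp.mpr (div_le_div_of_nonneg_left (norm_nonneg _) hnr hmr)
  calc _ ≤ ‖En m u + I * u‖ + ‖En n u + I * u‖ := norm_sub_le _ _
    _ ≤ ‖u‖ ^ 2 * Real.exp (‖u‖ / m) / m + ‖u‖ ^ 2 * Real.exp (‖u‖ / n) / n := add_le_add h1 h2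
    _ ≤ ‖u‖ ^ 2 * Real.exp (‖u‖ / n) / n + ‖u‖ ^ 2 * Real.exp (‖u‖ / n) / n := by
        gcongr
    _ = 2 * ‖u‖ ^ 2 * Real.exp (‖u‖ / n) / n := by ring

/-- the constant of the leaf rate. [folklore] -/
def Cv : ℝ := 128 * (1 + Real.exp (1 / 2)) * Real.exp (Real.pi + 2)

/-- `0 ≤ Cv`. [folklore] -/
theorem Cv_nonneg : 0 ≤ Cv := by unfold Cv; positivity

/-- **THE ABSOLUTE RATE OF THE BLOCK MEAN**: `‖g_m(u) − g_n(u)‖ ≤ Cv/n` for `2 ≤ n ≤ m` on the extended range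
`|Re u| ≤ πn + π + 1/4`, `|Im u| ≤ 1/2` — uniformly in the alias (no relative rate is claimed: for `‖u‖ ∼ n` the
two means are both `O(1/‖u‖)` and genuinely differ at that order). [folklore] -/
theorem norm_gm_sub_gm_le {n m : ℕ} (hn : 2 ≤ n) (hnm : n ≤ m) {u : ℂ}
    (hx : |u.re| ≤ Real.pi * n + Real.pi + 1 / 4) (hy : |u.im| ≤ 1 / 2) :
    ‖gm m u - gm n u‖ ≤ Cv / n := by
  have hm : 2 ≤ m := hn.trans hnm
  have hnr : (2 : ℝ) ≤ n := by exact_mod_cast hn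
  have hmr : (n : ℝ) ≤ m := by exact_mod_cast hnm
  have hnpos : (0 : ℝ) < n := by linarith
  by_cases hu : u = 0
  · subst hu
    rw [gm_zero m (by omega), gm_zero n (by omega), sub_self, norm_zero]
    exact div_nonneg Cv_nonneg hnpos.le
  have hu0 : 0 < ‖u‖ := norm_pos_iff.mpr hu
  have hxm : |u.re| ≤ Real.pi * m + Real.pi + 1 / 4 := by nlinarith [Real.pi_pos]
  have ln := norm_En_ge n hn hx hy
  have lm := norm_En_ge m hm hxm hy
  have hEn : En n u ≠ 0 := fun h => by rw [h, norm_zero] at ln; linarith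
  have hEm : En m u ≠ 0 := fun h => by rw [h, norm_zero] at lm; linarith
  rw [gm_eq_quotient m (by omega) hEm, gm_eq_quotient n (by omega) hEn, div_sub_div _ _ hEm hEn]
  have hnum : ‖cexp (-(I * u))‖ ≤ Real.exp (1 / 2) := by
    rw [Complex.norm_exp]
    simp only [neg_re, mul_re, Complex.I_re, Complex.I_im, zero_mul, one_mul, zero_sub, neg_neg]
    exact Real.exp_le_exp.mpr (abs_le.mp hy).2
  have hnum' : ‖cexp (-(I * u)) - 1‖ ≤ 1 + Real.exp (1 / 2) := by
    calc _ ≤ ‖cexp (-(I * u))‖ + ‖(1 : ℂ)‖ := norm_sub_le _ _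
      _ ≤ 1 + Real.exp (1 / 2) := by rw [norm_one]; linarith
  have e : (cexp (-(I * u)) - 1) * En n u - En m u * (cexp (-(I * u)) - 1)
      = -((cexp (-(I * u)) - 1) * (En m u - En n u)) := by ring
  rw [e, norm_div, norm_neg, norm_mul, norm_mul]
  have hrate := norm_En_sub_En_le (show 1 ≤ n by omega) hnm u
  have hwn : ‖u‖ ≤ (Real.pi + 2) * n := by
    have h1 := Complex.norm_le_abs_re_add_abs_im u
    have h2 := Real.pi_lt_d2
    have h3 : (Real.pi + 2) * n = Real.pi * n + 2 * n := by ring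
    rw [h3]; linarith
  have hexp : Real.exp (‖u‖ / n) ≤ Real.exp (Real.pi + 2) := by
    rw [Real.exp_le_exp, div_le_iff₀ hnpos]; exact hwn
  have hden : ‖u‖ / 8 * (‖u‖ / 8) ≤ ‖En m u‖ * ‖En n u‖ := mul_le_mul lm ln (by positivity) (norm_nonneg _)
  have hden0 : 0 < ‖u‖ / 8 * (‖u‖ / 8) := by positivity
  calc ‖cexp (-(I * u)) - 1‖ * ‖En m u - En n u‖ / (‖En m u‖ * ‖En n u‖)
      ≤ (1 + Real.exp (1 / 2)) * (2 * ‖u‖ ^ 2 * Real.exp (‖u‖ / n) / n) / (‖u‖ / 8 * (‖u‖ / 8)) := by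
        refine div_le_div₀ (by positivity) ?_ hden0 hden
        exact mul_le_mul hnum' hrate (norm_nonneg _) (by positivity)
    _ = 128 * (1 + Real.exp (1 / 2)) * Real.exp (‖u‖ / n) / n := by
        field_simp
        ring
    _ ≤ Cv / n := by
        unfold Cv
        gcongr

/-- `ω_n(l_μ) ≤ ω_m(ι(l)_μ)` in the form `12/ω_m(ι l_μ) ≤ 12/ω_n(l_μ)`. [folklore] -/
theorem div_omega_iota_le {n m : ℕ} {j : ℕ} (hj : j < n) (hnm : n ≤ m) (c : ℝ) (hc : 0 ≤ c) :
    c / omega m (iota n m j) ≤ c / omega n j :=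
  div_le_div_of_nonneg_left hc (omega_pos n j hj) (omega_le_omega_iota j hnm)

/-- rate-and-bound package of ONE LEAF `v̄C_μ`: bound `12/ω_n(l_μ)`, rate `Cv/n` (`2 ≤ n ≤ m`, fat box). [folklore] -/
theorem vCbar_RB {n m : ℕ} [NeZero n] [NeZero m] (hn : 2 ≤ n) (hnm : n ≤ m) {r : ℝ} (hr : r ≤ 1 / 4)
    {p : Fin d → ℂ} (hp : p ∈ Fat d r) (k : Fin d → Fin n) (μ : Fin d) :
    RB (vCbar m (iotaK n m hnm k) p μ) (vCbar n k p μ) (12 / omega n (k μ)) (Cv / n) := by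
  have hx : |(p μ).re| ≤ Real.pi + 1 / 4 := fat_re hr hp μ
  have hy : |(p μ).im| ≤ 1 / 2 := fat_im hr hp μ
  refine ⟨?_, norm_vCbar_le_omega n hr hp k μ, ?_⟩
  · have h := norm_vCbar_le_omega m hr hp (iotaK n m hnm k) μ
    rw [iotaK_val] at h
    exact h.trans (div_omega_iota_le (k μ).isLt hnm 12 (by norm_num))
  · rw [vCbar_iotaK_eq_gm, vCbar_eq_gm]
    refine norm_gm_sub_gm_le hn hnm (abs_wc_re_le (k μ).isLt hx) ?_
    rw [wc_im]; exact hy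

/-- the product `∂_μ·v̄C_μ` in the recentred variable: `= e^{i wc/N}(1 − e^{−ip′_μ})` at level `n`. [folklore] -/
theorem dC_mul_vCbar_eq (n : ℕ) [NeZero n] (k : Fin d → Fin n) (p : Fin d → ℂ) (μ : Fin d) :
    dC n k p μ * vCbar n k p μ = cexp (I * wc n (k μ) (p μ) / n) * (1 - cexp (-(I * p μ))) := by
  have hn : (n : ℂ) ≠ 0 := Nat.cast_ne_zero.mpr (NeZero.ne n)
  rw [dC_mul_vCbar, ← exp_shift_eq_exp_wc n k p μ]
  have e : -(shift n k p μ / n * I * ((n : ℂ) - 1)) = shift n k p μ / n * I + -(shift n k p μ * I) := by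
    field_simp; ring
  rw [e, Complex.exp_add]
  have hper : cexp (-(shift n k p μ * I)) = cexp (-(I * p μ)) := by
    simp only [shift]
    rw [show -((p μ + 2 * Real.pi * (((k μ : ℕ) : ℂ))) * I) = -(I * p μ) + -(((k μ : ℕ) : ℂ) * (2 * Real.pi * I)) by
      ring]
    rw [Complex.exp_add, Complex.exp_neg (((k μ : ℕ) : ℂ) * (2 * Real.pi * I)), Complex.exp_nat_mul_two_pi_mul_I,
      inv_one, mul_one]
  rw [hper]; ring

/-- the same at level `m` and the paired alias: `∂_μ·v̄C_μ = e^{i wc/m}(1 − e^{−ip′_μ})`. [folklore] -/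
theorem dC_mul_vCbar_iotaK_eq {n m : ℕ} [NeZero m] (hnm : n ≤ m) (k : Fin d → Fin n) (p : Fin d → ℂ) (μ : Fin d) :
    dC m (iotaK n m hnm k) p μ * vCbar m (iotaK n m hnm k) p μ
      = cexp (I * wc n (k μ) (p μ) / m) * (1 - cexp (-(I * p μ))) := by
  have hm : (m : ℂ) ≠ 0 := Nat.cast_ne_zero.mpr (NeZero.ne m)
  rw [dC_mul_vCbar, ← exp_shift_iotaK_eq_exp_wc hnm k p μ]
  set K := iotaK n m hnm k
  have e : -(shift m K p μ / m * I * ((m : ℂ) - 1)) = shift m K p μ / m * I + -(shift m K p μ * I) := by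
    field_simp; ring
  rw [e, Complex.exp_add]
  have hper : cexp (-(shift m K p μ * I)) = cexp (-(I * p μ)) := by
    simp only [shift]
    rw [show -((p μ + 2 * Real.pi * (((K μ : ℕ) : ℂ))) * I) = -(I * p μ) + -(((K μ : ℕ) : ℂ) * (2 * Real.pi * I)) by
      ring]
    rw [Complex.exp_add, Complex.exp_neg (((K μ : ℕ) : ℂ) * (2 * Real.pi * I)), Complex.exp_nat_mul_two_pi_mul_I,
      inv_one, mul_one]
  rw [hper]; ring

/-- the constant of the `∂v̄`-rate. [folklore] -/
def Cp : ℝ := 11 * (1 + Real.exp (1 / 2)) * Real.exp (1 / 4) * Real.exp (Real.pi + 2)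

/-- `0 ≤ Cp`. [folklore] -/
theorem Cp_nonneg : 0 ≤ Cp := by unfold Cp; positivity

/-- **THE RATE OF `∂_μ·v̄C_μ`**: `‖(∂v̄)_m(ι l) − (∂v̄)_n(l)‖ ≤ Cp·ω_n(l_μ)/n` on the fat box (`2 ≤ n ≤ m`) — an
absolute rate growing linearly in the alias distance (the fine phase `e^{i wc/N}` moves by `O(‖wc‖/n)`). [folklore] -/
theorem norm_dC_mul_vCbar_sub_le {n m : ℕ} [NeZero n] [NeZero m] (hn : 2 ≤ n) (hnm : n ≤ m) {r : ℝ}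
    (hr : r ≤ 1 / 4) {p : Fin d → ℂ} (hp : p ∈ Fat d r) (k : Fin d → Fin n) (μ : Fin d) :
    ‖dC m (iotaK n m hnm k) p μ * vCbar m (iotaK n m hnm k) p μ - dC n k p μ * vCbar n k p μ‖
      ≤ Cp * omega n (k μ) / n := by
  have hx : |(p μ).re| ≤ Real.pi + 1 / 4 := fat_re hr hp μ
  have hy : |(p μ).im| ≤ 1 / 2 := fat_im hr hp μ
  have hnr : (2 : ℝ) ≤ n := by exact_mod_cast hn
  have hmr : (n : ℝ) ≤ m := by exact_mod_cast hnm
  have hnpos : (0 : ℝ) < n := by linarith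
  have hmpos : (0 : ℝ) < m := by linarith
  set u := wc n (k μ) (p μ) with hu
  rw [dC_mul_vCbar_iotaK_eq, dC_mul_vCbar_eq, ← sub_mul, norm_mul]
  have hfac : ‖1 - cexp (-(I * p μ))‖ ≤ 1 + Real.exp (1 / 2) := by
    calc _ ≤ ‖(1 : ℂ)‖ + ‖cexp (-(I * p μ))‖ := norm_sub_le _ _
      _ ≤ 1 + Real.exp (1 / 2) := by
          rw [norm_one, Complex.norm_exp]
          simp only [neg_re, mul_re, Complex.I_re, Complex.I_im, zero_mul, one_mul, zero_sub, neg_neg]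
          have := Real.exp_le_exp.mpr (abs_le.mp hy).2
          linarith
  -- `e^{iu/m} − e^{iu/n} = e^{iu/n}(e^{iu(1/m − 1/n)} − 1)`
  have hun : ‖u‖ ≤ 11 * omega n (k μ) := norm_wc_le (k μ).isLt hx hy
  have hω := (omega_pos n (k μ) (k μ).isLt).le
  have huim : |u.im| ≤ 1 / 2 := by rw [hu, wc_im]; exact hy
  have hwn : ‖u‖ ≤ (Real.pi + 2) * n := by
    have h1 := Complex.norm_le_abs_re_add_abs_im u
    have h2 := Real.pi_lt_d2
    have h4 := abs_wc_re_le (n := n) (k μ).isLt hx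
    have h3 : (Real.pi + 2) * n = Real.pi * n + 2 * n := by ring
    rw [← hu] at h4
    rw [h3]; linarith
  set δ : ℂ := I * u / m - I * u / n with hδ
  have e : cexp (I * u / m) - cexp (I * u / n) = cexp (I * u / n) * (cexp δ - 1) := by
    rw [mul_sub, mul_one, ← Complex.exp_add, hδ, add_sub_cancel]
  have hb1 : ‖cexp (I * u / n)‖ ≤ Real.exp (1 / 4) := by
    rw [Complex.norm_exp]
    refine Real.exp_le_exp.mpr ?_
    have : (I * u / (n : ℂ)).re = -u.im / n := by
      simp [Complex.div_re, Complex.normSq_apply]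
      have hn0 : (n : ℝ) ≠ 0 := hnpos.ne'
      field_simp
    rw [this, div_le_iff₀ hnpos]
    have := (abs_le.mp huim).1
    nlinarith
  have hδn : ‖δ‖ ≤ ‖u‖ / n := by
    have e2 : δ = (I * u) * ((1 : ℂ) / m - 1 / n) := by rw [hδ]; ring
    rw [e2, norm_mul, norm_mul, Complex.norm_I, one_mul]
    have h3 : ‖(1 : ℂ) / m - 1 / n‖ = 1 / n - 1 / m := by
      have : (1 : ℂ) / m - 1 / n = (((1 : ℝ) / m - 1 / n : ℝ) : ℂ) := by push_cast; ring
      rw [this, Complex.norm_real, Real.norm_eq_abs, abs_of_nonpos (by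
        rw [sub_nonpos]; exact one_div_le_one_div_of_le hnpos hmr)]
      ring
    rw [h3]
    have : 1 / (n : ℝ) - 1 / m ≤ 1 / n := by
      have : 0 ≤ 1 / (m : ℝ) := by positivity
      linarith
    calc ‖u‖ * (1 / (n : ℝ) - 1 / m) ≤ ‖u‖ * (1 / n) := by gcongr
      _ = ‖u‖ / n := by ring
  have hδ1 : ‖cexp δ - 1‖ ≤ ‖u‖ / n * Real.exp (Real.pi + 2) := by
    have h1 := Complex.norm_exp_sub_sum_le_norm_mul_exp δ 1
    simp only [Finset.range_one, Finset.sum_singleton, pow_zero, Nat.factorial_zero, Nat.cast_one, div_one,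
      pow_one] at h1
    refine h1.trans (mul_le_mul hδn (Real.exp_le_exp.mpr (hδn.trans ?_)) (Real.exp_pos _).le (by positivity))
    rw [div_le_iff₀ hnpos]; exact hwn
  rw [e, norm_mul]
  calc ‖cexp (I * u / n)‖ * ‖cexp δ - 1‖ * ‖1 - cexp (-(I * p μ))‖
      ≤ Real.exp (1 / 4) * (‖u‖ / n * Real.exp (Real.pi + 2)) * (1 + Real.exp (1 / 2)) := by
        gcongr
    _ ≤ Real.exp (1 / 4) * (11 * omega n (k μ) / n * Real.exp (Real.pi + 2)) * (1 + Real.exp (1 / 2)) := by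
        gcongr
    _ = Cp * omega n (k μ) / n := by unfold Cp; ring

/-- rate-and-bound package of `∂_μ·v̄C_μ`: bound `4`, rate `Cp·ω_n(l_μ)/n`. [folklore] -/
theorem dC_mul_vCbar_RB {n m : ℕ} [NeZero n] [NeZero m] (hn : 2 ≤ n) (hnm : n ≤ m) {r : ℝ} (hr : r ≤ 1 / 4)
    {p : Fin d → ℂ} (hp : p ∈ Fat d r) (k : Fin d → Fin n) (μ : Fin d) :
    RB (dC m (iotaK n m hnm k) p μ * vCbar m (iotaK n m hnm k) p μ) (dC n k p μ * vCbar n k p μ) 4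
      (Cp * omega n (k μ) / n) :=
  ⟨norm_dC_mul_vCbar_le m hr hp _ μ, norm_dC_mul_vCbar_le n hr hp k μ,
    norm_dC_mul_vCbar_sub_le hn hnm hr hp k μ⟩

/-- **PHASE MATCHING**: under the physical coarse-lattice condition `a′·n = a·m` (the SAME coarse point `x = a/n =
a′/m`), the alias phase of level `m` at the paired alias equals the alias phase of level `n`:
`e^{i(p′+ι l)·a′/m} = e^{i(p′+l)·a/n}`. [folklore] -/
theorem phase163_iotaK_eq {n m : ℕ} [NeZero n] [NeZero m] (hnm : n ≤ m) (k : Fin d → Fin n) (a : Fin d → Fin n)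
    (a' : Fin d → Fin m) (hphys : ∀ ν, (a' ν : ℕ) * n = (a ν : ℕ) * m) (p : Fin d → ℂ) :
    phase163 m (iotaK n m hnm k) a' p = phase163 n k a p := by
  unfold phase163
  refine Finset.prod_congr rfl (fun ν _ => ?_)
  rw [exp_shift_iotaK_eq_exp_wc, exp_shift_eq_exp_wc, ← Complex.exp_nat_mul, ← Complex.exp_nat_mul]
  congr 1
  have hn : (n : ℂ) ≠ 0 := Nat.cast_ne_zero.mpr (NeZero.ne n)
  have hm : (m : ℂ) ≠ 0 := Nat.cast_ne_zero.mpr (NeZero.ne m)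
  have h : ((a' ν : ℕ) : ℂ) * n = ((a ν : ℕ) : ℂ) * m := by exact_mod_cast hphys ν
  have hq : ((a' ν : ℕ) : ℂ) / m = ((a ν : ℕ) : ℂ) / n := by
    rw [div_eq_div_iff hm hn]; exact h
  calc ((a' ν : ℕ) : ℂ) * (I * wc n (k ν) (p ν) / m) = ((a' ν : ℕ) : ℂ) / m * (I * wc n (k ν) (p ν)) := by ring
    _ = ((a ν : ℕ) : ℂ) / n * (I * wc n (k ν) (p ν)) := by rw [hq]
    _ = ((a ν : ℕ) : ℂ) * (I * wc n (k ν) (p ν) / n) := by ring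

/-! ## §2 The alias profile `prof_N(K) = (Π_ν 12/ω_N(K_ν))·W_N(K)^{−1/2}` and its uniform summability -/

/-- the first-power alias product `Π_ν 12/ω_N(K_ν)`. [folklore] -/
def Pom (N : ℕ) (K : Fin d → Fin N) : ℝ := ∏ ν, 12 / omega N (K ν)

/-- the alias profile `(Π_ν 12/ω_N(K_ν))·(√W_N(K))⁻¹` (`= 0` at `K = 0`, where `W = 0`). [folklore] -/
def prof (N : ℕ) (K : Fin d → Fin N) : ℝ := Pom N K * (Real.sqrt (W N K))⁻¹

/-- `0 < Pom`. [folklore] -/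
theorem Pom_pos (N : ℕ) (K : Fin d → Fin N) : 0 < Pom N K :=
  Finset.prod_pos (fun ν _ => div_pos (by norm_num) (omega_pos N (K ν) (K ν).isLt))

/-- `0 ≤ prof`. [folklore] -/
theorem prof_nonneg (N : ℕ) (K : Fin d → Fin N) : 0 ≤ prof N K :=
  mul_nonneg (Pom_pos N K).le (inv_nonneg.mpr (Real.sqrt_nonneg _))

/-- splitting one coordinate off the alias product: `Π_{ν′ ≠ ν} 12/ω = (ω_ν/12)·Pom`. [folklore] -/
theorem prod_erase_eq_Pom (N : ℕ) (K : Fin d → Fin N) (ν : Fin d) :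
    ∏ ν' ∈ univ.erase ν, 12 / omega N (K ν') = omega N (K ν) / 12 * Pom N K := by
  have hω := (omega_pos N (K ν) (K ν).isLt).ne'
  unfold Pom
  rw [← Finset.mul_prod_erase _ _ (Finset.mem_univ ν)]
  field_simp

/-- `1 ≤ √W_N(K)` for `K ≠ 0`. [folklore] -/
theorem one_le_sqrtW (N : ℕ) [NeZero N] {K : Fin d → Fin N} (hK : K ≠ fun _ => 0) : 1 ≤ Real.sqrt (W N K) := by
  rw [show (1 : ℝ) = Real.sqrt 1 from Real.sqrt_one.symm]
  exact Real.sqrt_le_sqrt (one_le_W N K hK)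

/-- `ω_N(K_ν) ≤ √W_N(K)` for `K ≠ 0` (every coordinate, also those with `K_ν = 0`). [folklore] -/
theorem omega_le_sqrtW (N : ℕ) [NeZero N] {K : Fin d → Fin N} (hK : K ≠ fun _ => 0) (ν : Fin d) :
    omega N (K ν) ≤ Real.sqrt (W N K) := by
  have h := omega_sq_le_W N K hK ν
  calc omega N (K ν) = Real.sqrt (omega N (K ν) ^ 2) := (Real.sqrt_sq (omega_pos N (K ν) (K ν).isLt).le).symm
    _ ≤ Real.sqrt (W N K) := Real.sqrt_le_sqrt h

/-- `(√W)² = W`. [folklore] -/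
theorem sq_sqrtW (N : ℕ) (K : Fin d → Fin N) : Real.sqrt (W N K) ^ 2 = W N K := Real.sq_sqrt (W_nonneg N K)

/-- `ω_N(j) ≤ N`. [folklore] -/
theorem omega_le_level (N j : ℕ) : omega N j ≤ N := by
  have := omega_le_right N j
  have : (0 : ℝ) ≤ j := Nat.cast_nonneg j
  linarith

/-- King's weight is at most `d·N²`. [folklore] -/
theorem W_le (N : ℕ) (K : Fin d → Fin N) : W N K ≤ d * (N : ℝ) ^ 2 := by
  unfold W
  calc ∑ ν, (if (K ν : ℕ) = 0 then (0 : ℝ) else omega N (K ν) ^ 2) ≤ ∑ _ν : Fin d, (N : ℝ) ^ 2 := by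
        refine Finset.sum_le_sum (fun ν _ => ?_)
        split_ifs
        · positivity
        · exact pow_le_pow_left₀ (omega_pos N (K ν) (K ν).isLt).le (omega_le_level N (K ν)) 2
    _ = d * (N : ℝ) ^ 2 := by simp

/-- `√W_N(K) ≤ d·N`. [folklore] -/
theorem sqrtW_le (N : ℕ) (K : Fin d → Fin N) : Real.sqrt (W N K) ≤ d * N := by
  have hd : (d : ℝ) ≤ (d : ℝ) ^ 2 := by
    rcases Nat.eq_zero_or_pos d with h | h
    · subst h; simp
    · have : (1 : ℝ) ≤ d := by exact_mod_cast h
      nlinarith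
  have h : W N K ≤ ((d : ℝ) * N) ^ 2 := by
    calc W N K ≤ d * (N : ℝ) ^ 2 := W_le N K
      _ ≤ (d : ℝ) ^ 2 * (N : ℝ) ^ 2 := by gcongr
      _ = ((d : ℝ) * N) ^ 2 := by ring
  calc Real.sqrt (W N K) ≤ Real.sqrt (((d : ℝ) * N) ^ 2) := Real.sqrt_le_sqrt h
    _ = d * N := Real.sqrt_sq (by positivity)

/-- the level in the profile currency: `1/N ≤ d/√W_N(K)` for `K ≠ 0`. [folklore] -/
theorem inv_level_le (N : ℕ) [NeZero N] {K : Fin d → Fin N} (hK : K ≠ fun _ => 0) :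
    ((N : ℝ))⁻¹ ≤ d * (Real.sqrt (W N K))⁻¹ := by
  have hs := one_le_sqrtW N hK
  have hN : (0 : ℝ) < N := by exact_mod_cast Nat.pos_of_ne_zero (NeZero.ne N)
  rw [← div_eq_mul_inv, inv_eq_one_div, div_le_div_iff₀ hN (by linarith), one_mul]
  exact sqrtW_le N K

/-- `(√W)⁻¹ ≤ Π_ν ω_N(K_ν)^{−1/d}` for `K ≠ 0` (square root of `B4StripSums.inv_W_le_prod_rpow`). [folklore] -/
theorem inv_sqrtW_le_prod_rpow (N : ℕ) [NeZero N] (hd : 0 < d) {K : Fin d → Fin N} (hK : K ≠ fun _ => 0) :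
    (Real.sqrt (W N K))⁻¹ ≤ ∏ ν, omega N (K ν) ^ (-(1 : ℝ) / d) := by
  have h := inv_W_le_prod_rpow N hd K hK
  rw [one_div] at h
  have hR : 0 ≤ ∏ ν, omega N (K ν) ^ (-(1 : ℝ) / d) :=
    Finset.prod_nonneg (fun ν _ => Real.rpow_nonneg (omega_pos N (K ν) (K ν).isLt).le _)
  have hsq : (∏ ν, omega N (K ν) ^ (-(1 : ℝ) / d)) ^ 2 = ∏ ν, omega N (K ν) ^ (-(2 : ℝ) / d) := by
    rw [← Finset.prod_pow]
    refine Finset.prod_congr rfl (fun ν _ => ?_)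
    rw [← Real.rpow_natCast, ← Real.rpow_mul (omega_pos N (K ν) (K ν).isLt).le]
    congr 1
    push_cast
    ring
  calc (Real.sqrt (W N K))⁻¹ = Real.sqrt ((W N K)⁻¹) := (Real.sqrt_inv _).symm
    _ ≤ Real.sqrt (∏ ν, omega N (K ν) ^ (-(2 : ℝ) / d)) := Real.sqrt_le_sqrt h
    _ = ∏ ν, omega N (K ν) ^ (-(1 : ℝ) / d) := by rw [← hsq, Real.sqrt_sq hR]

/-- the profile is dominated by the summable product `12^d Π_ν ω_N(K_ν)^{−(1+1/d)}` (all `K`). [folklore] -/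
theorem prof_le_prod_rpow (N : ℕ) [NeZero N] (hd : 0 < d) (K : Fin d → Fin N) :
    prof N K ≤ 12 ^ d * ∏ ν, omega N (K ν) ^ (-(1 + 1 / (d : ℝ))) := by
  have hR : 0 ≤ 12 ^ d * ∏ ν, omega N (K ν) ^ (-(1 + 1 / (d : ℝ))) :=
    mul_nonneg (by positivity) (Finset.prod_nonneg (fun ν _ => Real.rpow_nonneg (omega_pos N (K ν) (K ν).isLt).le _))
  by_cases hK : K = fun _ => 0
  · have hW : W N K = 0 := by subst hK; unfold W; simp
    unfold prof
    rw [hW, Real.sqrt_zero, inv_zero, mul_zero]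
    exact hR
  · unfold prof Pom
    calc (∏ ν, 12 / omega N (K ν)) * (Real.sqrt (W N K))⁻¹
        ≤ (∏ ν, 12 / omega N (K ν)) * ∏ ν, omega N (K ν) ^ (-(1 : ℝ) / d) :=
          mul_le_mul_of_nonneg_left (inv_sqrtW_le_prod_rpow N hd hK) (Pom_pos N K).le
      _ = 12 ^ d * ∏ ν, omega N (K ν) ^ (-(1 + 1 / (d : ℝ))) := by
          rw [← Finset.prod_mul_distrib]
          have e : ∀ ν, 12 / omega N (K ν) * omega N (K ν) ^ (-(1 : ℝ) / d)
              = 12 * omega N (K ν) ^ (-(1 + 1 / (d : ℝ))) := by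
            intro ν
            have hω := omega_pos N (K ν) (K ν).isLt
            rw [show -(1 + 1 / (d : ℝ)) = (-1 : ℝ) + (-(1 : ℝ) / d) by ring, Real.rpow_add hω,
              Real.rpow_neg_one]
            ring
          simp_rw [e]
          rw [Finset.prod_mul_distrib]
          simp

/-- `Σ_j ω_N(j)^{−(1+1/d)} ≤ 2ζ_{2d}`. [folklore] -/
theorem sum_omega_rpow_le' (N : ℕ) (hd : 0 < d) :
    ∑ j : Fin N, omega N j ^ (-(1 + 1 / (d : ℝ))) ≤ 2 * zetaC (2 * d) := by
  have h := sum_omega_rpow_le (d := 2 * d) N (by omega)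
  have e : -(1 + 2 / ((2 * d : ℕ) : ℝ)) = -(1 + 1 / (d : ℝ)) := by
    have hd' : (d : ℝ) ≠ 0 := by exact_mod_cast hd.ne'
    push_cast
    field_simp
  rwa [e] at h

/-- the uniform bound of the profile sums. [folklore] -/
def Cprof (d : ℕ) : ℝ := 12 ^ d * (2 * zetaC (2 * d)) ^ d

/-- `0 ≤ Cprof`. [folklore] -/
theorem Cprof_nonneg (d : ℕ) : 0 ≤ Cprof d := by unfold Cprof; have := zetaC_nonneg (2 * d); positivity

/-- **UNIFORM SUMMABILITY OF THE PROFILE**: `Σ_{K ∈ ℤ_N^d} prof_N(K) ≤ Cprof(d)` for every level `N ≥ 1`. [folklore] -/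
theorem sum_prof_le (N : ℕ) [NeZero N] : ∑ K : Fin d → Fin N, prof N K ≤ Cprof d := by
  rcases Nat.eq_zero_or_pos d with hd | hd
  · subst hd
    have h0 : ∀ K : Fin 0 → Fin N, prof N K = 0 := by
      intro K; unfold prof W; simp
    simp only [h0, Finset.sum_const_zero]
    exact Cprof_nonneg 0
  · have h := Finset.prod_univ_sum (fun _ : Fin d => (Finset.univ : Finset (Fin N)))
      (fun _ν j => omega N (j : ℕ) ^ (-(1 + 1 / (d : ℝ))))
    rw [Fintype.piFinset_univ] at h
    have hz := zetaC_nonneg (2 * d)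
    calc ∑ K : Fin d → Fin N, prof N K ≤ ∑ K : Fin d → Fin N, 12 ^ d * ∏ ν, omega N (K ν) ^ (-(1 + 1 / (d : ℝ))) :=
          Finset.sum_le_sum (fun K _ => prof_le_prod_rpow N hd K)
      _ = 12 ^ d * ∏ _ν : Fin d, ∑ j : Fin N, omega N j ^ (-(1 + 1 / (d : ℝ))) := by
          rw [← Finset.mul_sum, h]
      _ ≤ 12 ^ d * ∏ _ν : Fin d, (2 * zetaC (2 * d)) := by
          refine mul_le_mul_of_nonneg_left (Finset.prod_le_prod (fun _ _ => Finset.sum_nonneg (fun j _ =>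
            Real.rpow_nonneg (omega_pos N j j.isLt).le _)) (fun _ _ => sum_omega_rpow_le' N hd)) (by positivity)
      _ = Cprof d := by unfold Cprof; simp

/-- the paired profile of level `m` is dominated by the level-`n` profile: `Pom_m(ι k) ≤ Pom_n(k)`. [folklore] -/
theorem Pom_iotaK_le {n m : ℕ} (hnm : n ≤ m) (k : Fin d → Fin n) : Pom m (iotaK n m hnm k) ≤ Pom n k := by
  unfold Pom
  refine Finset.prod_le_prod (fun ν _ => by have := omega_pos m _ (iotaK n m hnm k ν).isLt; positivity)
    (fun ν _ => ?_)
  rw [iotaK_val]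
  exact div_omega_iota_le (k ν).isLt hnm 12 (by norm_num)

/-- an UNPAIRED alias of level `m` has `W_m(K)⁻¹ ≤ (2/n)·(√W_m(K))⁻¹`. [folklore] -/
theorem inv_W_unpaired_le {n m : ℕ} [NeZero m] (hn : 1 ≤ n) {K : Fin d → Fin m} (hK : K ≠ fun _ => 0)
    (hP : ¬ ∀ ν, Paired n m (K ν)) : (W m K)⁻¹ ≤ 2 / n * (Real.sqrt (W m K))⁻¹ := by
  obtain ⟨ν₀, hν₀⟩ := not_forall.mp hP
  have hω := le_two_omega_of_not_paired hν₀
  have hs := omega_le_sqrtW m hK ν₀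
  have hs1 := one_le_sqrtW m hK
  have hnr : (1 : ℝ) ≤ n := by exact_mod_cast hn
  have hns : (n : ℝ) ≤ 2 * Real.sqrt (W m K) := hω.trans (by linarith)
  set s := Real.sqrt (W m K) with hs_def
  have hs0 : 0 < s := by linarith
  have h1 : s⁻¹ ≤ 2 / n := by
    rw [inv_eq_one_div, div_le_div_iff₀ hs0 (by positivity)]
    linarith
  calc (W m K)⁻¹ = (s ^ 2)⁻¹ := by rw [hs_def, sq_sqrtW m K]
    _ = s⁻¹ * s⁻¹ := by rw [sq, mul_inv]
    _ ≤ 2 / n * s⁻¹ := mul_le_mul_of_nonneg_right h1 (inv_nonneg.mpr hs0.le)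

/-! ## §3 Rate-and-bound packages of the composite factors of (1.63) -/

/-! ### §3.1 Three more rules of the `RB` calculus -/

/-- differences of packages. [folklore] -/
theorem RB_sub {a b a' b' : ℂ} {B ρ B' ρ' : ℝ} (h : RB a b B ρ) (h' : RB a' b' B' ρ') :
    RB (a - a') (b - b') (B + B') (ρ + ρ') := by
  refine ⟨(norm_sub_le _ _).trans (add_le_add h.left h'.left),
    (norm_sub_le _ _).trans (add_le_add h.right h'.right), ?_⟩
  calc ‖a - a' - (b - b')‖ = ‖(a - b) - (a' - b')‖ := by ring_nf
    _ ≤ ‖a - b‖ + ‖a' - b'‖ := norm_sub_le _ _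
    _ ≤ ρ + ρ' := add_le_add h.sub h'.sub

/-- quotients of packages over denominators bounded below by `c₀ > 0`. [folklore] -/
theorem RB_div {a b a' b' : ℂ} {B ρ B' ρ' c₀ : ℝ} (hc : 0 < c₀) (h : RB a b B ρ) (h' : RB a' b' B' ρ')
    (ha' : c₀ ≤ ‖a'‖) (hb' : c₀ ≤ ‖b'‖) : RB (a / a') (b / b') (B / c₀) (ρ / c₀ + B * ρ' / c₀ ^ 2) := by
  refine ⟨?_, ?_, norm_div_sub_div_le hc h.left h.sub h'.sub ha' hb'⟩
  · rw [norm_div]; exact div_le_div₀ h.B_nonneg h.left hc ha'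
  · rw [norm_div]; exact div_le_div₀ h.B_nonneg h.right hc hb'

/-- inverses of packages over a lower bound `c₀ > 0`. [folklore] -/
theorem RB_inv {a' b' : ℂ} {B' ρ' c₀ : ℝ} (hc : 0 < c₀) (h' : RB a' b' B' ρ') (ha' : c₀ ≤ ‖a'‖)
    (hb' : c₀ ≤ ‖b'‖) : RB (a'⁻¹) (b'⁻¹) (1 / c₀) (ρ' / c₀ ^ 2) := by
  have h := RB_div hc (RB.of_eq (1 : ℂ) (le_of_eq norm_one)) h' ha' hb'
  rw [one_div a', one_div b'] at h
  exact h.mono le_rfl (by ring_nf; exact le_rfl)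

/-! ### §3.2 The inner alias sum `Σ_{l′ ≠ l} A(l,l′)` in closed form -/

/-- **THE INNER ALIAS SUM IN CLOSED FORM** (`l ≠ 0`): with `Δ_l = Δ(p′+l)`, `Δ₀ = Δ(p′)`,
`Σ_{l′≠l} A(l,l′) = U₀u₀Δ₀/Δ_l² − U₀u(l_μ)/Δ_l + (Δ₀/Δ_l)²(R̃_μ − T_μ(l)) − (u(l_μ)/Δ_l)Δ₀²(X_{≠0} − U_l/Δ_l²)` — the
double alias sum of (1.63) is three single alias sums (`R̃`, `X_{≠0}`) and local terms. [folklore] -/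
theorem sum_Afac_eq (N : ℕ) [NeZero N] (μ : Fin d) {K : Fin d → Fin N} (hK : K ≠ fun _ => 0)
    (p : Fin d → ℂ) :
    ∑ k' ∈ univ.erase K, B5Hk163Strip.Afac N μ K k' p
      = U N (fun _ => 0) p * uFactor N 0 (p μ) * DeltaXi N 0 p / DeltaXi N 0 (shift N K p) ^ 2
        - U N (fun _ => 0) p * uFactor N (K μ : ℕ) (p μ) / DeltaXi N 0 (shift N K p)
        + (DeltaXi N 0 p / DeltaXi N 0 (shift N K p)) ^ 2 * (Rt N μ p - T166 N μ K p)
        - uFactor N (K μ : ℕ) (p μ) / DeltaXi N 0 (shift N K p) * DeltaXi N 0 p ^ 2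
            * (Xne N p - U N K p / DeltaXi N 0 (shift N K p) ^ 2) := by
  have h0mem : (fun _ => (0 : Fin N)) ∈ univ.erase K :=
    Finset.mem_erase.mpr ⟨fun h => hK h.symm, Finset.mem_univ _⟩
  have hKmem : K ∈ univ.erase (fun _ => (0 : Fin N)) := Finset.mem_erase.mpr ⟨hK, Finset.mem_univ _⟩
  rw [← Finset.add_sum_erase _ _ h0mem, Finset.erase_right_comm]
  have hsummand : ∀ k' ∈ (univ.erase (fun _ => (0 : Fin N))).erase K, B5Hk163Strip.Afac N μ K k' p
      = (DeltaXi N 0 p / DeltaXi N 0 (shift N K p)) ^ 2 * T166 N μ k' p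
        - uFactor N (K μ : ℕ) (p μ) / DeltaXi N 0 (shift N K p) * DeltaXi N 0 p ^ 2
            * (U N k' p / DeltaXi N 0 (shift N k' p) ^ 2) := by
    intro k' hk'
    have hk'0 : k' ≠ fun _ => 0 := (Finset.mem_erase.mp (Finset.mem_erase.mp hk').2).1
    unfold B5Hk163Strip.Afac Tfac B5Hk163Strip.rho T166
    rw [if_neg hk'0, if_neg hK, if_neg hK, if_neg hk'0]
    ring
  rw [Finset.sum_congr rfl hsummand, Finset.sum_sub_distrib, ← Finset.mul_sum, ← Finset.mul_sum,
    Finset.sum_erase_eq_sub hKmem, Finset.sum_erase_eq_sub hKmem, ← Rt_eq_sum]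
  have hX : ∑ k' ∈ univ.erase (fun _ => (0 : Fin N)), U N k' p / DeltaXi N 0 (shift N k' p) ^ 2 = Xne N p := rfl
  rw [hX]
  have hT0 : B5Hk163Strip.Afac N μ K (fun _ => 0) p
      = U N (fun _ => 0) p * uFactor N 0 (p μ) * DeltaXi N 0 p / DeltaXi N 0 (shift N K p) ^ 2
        - U N (fun _ => 0) p * uFactor N (K μ : ℕ) (p μ) / DeltaXi N 0 (shift N K p) := by
    unfold B5Hk163Strip.Afac Tfac B5Hk163Strip.rho
    rw [if_pos rfl, if_neg hK, if_pos rfl]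
    simp only [Fin.val_zero]
    ring
  rw [hT0]
  ring

/-- the inner alias sum at the ZERO alias: `Σ_{l′≠0} A(0,l′) = R̃_μ − u₀(p′_μ)Δ₀X_{≠0}`. [folklore] -/
theorem sum_Afac_zero_eq (N : ℕ) [NeZero N] (μ : Fin d) (p : Fin d → ℂ) :
    ∑ k' ∈ univ.erase (fun _ => (0 : Fin N)), B5Hk163Strip.Afac N μ (fun _ => 0) k' p
      = Rt N μ p - uFactor N 0 (p μ) * DeltaXi N 0 p * Xne N p := by
  have hsummand : ∀ k' ∈ univ.erase (fun _ => (0 : Fin N)), B5Hk163Strip.Afac N μ (fun _ => 0) k' p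
      = T166 N μ k' p - uFactor N 0 (p μ) * DeltaXi N 0 p * (U N k' p / DeltaXi N 0 (shift N k' p) ^ 2) := by
    intro k' hk'
    have hk'0 : k' ≠ fun _ => 0 := (Finset.mem_erase.mp hk').1
    unfold B5Hk163Strip.Afac Tfac B5Hk163Strip.rho T166
    rw [if_neg hk'0, if_pos rfl, if_pos rfl]
    simp only [Fin.val_zero]
    ring
  rw [Finset.sum_congr rfl hsummand, Finset.sum_sub_distrib, ← Finset.mul_sum, ← Rt_eq_sum]
  rfl

/-! ### §3.3 Packages of `Δ_l⁻¹`, `ρ_l`, `T(l)`, `X_{≠0}`, `𝒩` at paired aliases -/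

section Paired

variable {n m : ℕ} [NeZero n] [NeZero m] (hn : 2 ≤ n) (hnm : n ≤ m) {r : ℝ} (hr : r ≤ 1 / 4)
  (hdr : (d : ℝ) * r ^ 2 ≤ 1 / 16) {p : Fin d → ℂ} (hp : p ∈ Fat d r)
include hn hnm hr hdr hp

/-- package of `Δ(p′+l)⁻¹` at a paired alias: bound `(64/7)/W_n(l)`, rate `CD(d)/n²`. [folklore] -/
theorem SWinv_RB {k : Fin d → Fin n} (hk : k ≠ fun _ => 0) :
    RB ((SW m n k p)⁻¹) ((SW n n k p)⁻¹) (64 / 7 / W n k) (CD d / (n : ℝ) ^ 2) :=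
  ⟨norm_inv_SWm_le hnm hr hdr hp hk, norm_inv_SW_le n hr hdr hp hk, norm_inv_SW_sub_le hn hnm hr hdr hp hk⟩

/-- the constant of the `ρ_l`-rate. [folklore] -/
def Krho (d : ℕ) : ℝ := Bc d * CD d + KΔ d * (64 / 7)

omit hn hnm hr hdr hp in
/-- `0 ≤ Krho`. [folklore] -/
theorem Krho_nonneg (d : ℕ) : 0 ≤ Krho d := by
  unfold Krho; have := Bc_pos d; have := CD_nonneg d; have := KΔ_nonneg d; positivity

/-- package of the regrouped ratio `ρ_l = Δ₀/Δ_l` at a paired alias (`l ≠ 0`): bound `Bc(64/7)/W_n(l)`, rate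
`Krho(d)/n²`. [folklore] -/
theorem rho_RB {k : Fin d → Fin n} (hk : k ≠ fun _ => 0) :
    RB (B5Hk163Strip.rho m (iotaK n m hnm k) p) (B5Hk163Strip.rho n k p) (Bc d * (64 / 7 / W n k))
      (Krho d / (n : ℝ) ^ 2) := by
  have e1 : B5Hk163Strip.rho m (iotaK n m hnm k) p = DeltaXi m 0 p * (SW m n k p)⁻¹ := by
    unfold B5Hk163Strip.rho; rw [if_neg (iotaK_ne_zero hnm hk), DeltaXi_shift_iotaK_eq_SW, div_eq_mul_inv]
  have e2 : B5Hk163Strip.rho n k p = DeltaXi n 0 p * (SW n n k p)⁻¹ := by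
    unfold B5Hk163Strip.rho; rw [if_neg hk, DeltaXi_shift_eq_SW, div_eq_mul_inv]
  rw [e1, e2]
  have h := (DeltaXi0_RB hn hnm hr hp).mul (SWinv_RB hn hnm hr hdr hp hk)
  refine h.mono le_rfl ?_
  have hW := one_le_W n k hk
  have h1 : 64 / 7 / W n k ≤ 64 / 7 := div_le_self (by norm_num) hW
  have h2 : 0 ≤ KΔ d / (n : ℝ) ^ 2 := by have := KΔ_nonneg d; positivity
  have h3 : 0 ≤ CD d / (n : ℝ) ^ 2 := by have := CD_nonneg d; positivity
  have := Bc_pos d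
  calc Bc d * (CD d / (n : ℝ) ^ 2) + KΔ d / (n : ℝ) ^ 2 * (64 / 7 / W n k)
      ≤ Bc d * (CD d / (n : ℝ) ^ 2) + KΔ d / (n : ℝ) ^ 2 * (64 / 7) :=
        add_le_add le_rfl (mul_le_mul_of_nonneg_left h1 h2)
    _ = Krho d / (n : ℝ) ^ 2 := by unfold Krho; ring

omit hn hnm hr hdr hp in
/-- `cω_n(k) ≤ 64^d`. [folklore] -/
theorem cω_le (N : ℕ) (k : Fin d → Fin N) : cω N k ≤ 64 ^ d := by
  unfold cω
  calc ∏ ν, 64 / omega N (k ν) ^ 2 ≤ ∏ _ν : Fin d, (64 : ℝ) :=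
        Finset.prod_le_prod (fun ν _ => by have := omega_pos N (k ν) (k ν).isLt; positivity)
          (fun ν _ => div_le_self (by norm_num) (one_le_pow₀ (one_le_omega N _ (k ν).isLt)))
    _ = 64 ^ d := by simp

omit [NeZero n] [NeZero m] hn hr hdr hp in
/-- `cω_m(ι k) ≤ cω_n(k)`. [folklore] -/
theorem cω_iotaK_le (k : Fin d → Fin n) : cω m (iotaK n m hnm k) ≤ cω n k := by
  unfold cω
  refine Finset.prod_le_prod (fun ν _ => by have := omega_pos m _ (iotaK n m hnm k ν).isLt; positivity)
    (fun ν _ => ?_)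
  rw [iotaK_val]
  exact div_le_div_of_nonneg_left (by norm_num) (pow_pos (omega_pos n _ (k ν).isLt) 2)
    (pow_le_pow_left₀ (omega_pos n _ (k ν).isLt).le (omega_le_omega_iota _ hnm) 2)

/-- package of the `R̃`-summand `T_μ(l)` at a paired alias (`l ≠ 0`). [folklore] -/
theorem T166K_RB {k : Fin d → Fin n} (hk : k ≠ fun _ => 0) (lam : Fin d) :
    RB (T166 m lam (iotaK n m hnm k) p) (T166 n lam k p) (cω n k * 64 * (64 / 7 / W n k))
      (KT d / (n : ℝ) ^ 2 * cω n k) := by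
  refine ⟨?_, norm_T166_le n hr hdr hp hk lam, T166_rate hn hnm hr hdr hp hk lam⟩
  have h := norm_T166_le m hr hdr hp (iotaK_ne_zero hnm hk) lam
  refine h.trans ?_
  have h1 := cω_iotaK_le hnm k
  have h2 := W_le_W_iotaK hnm k
  have hW := one_le_W n k hk
  have hc := (cω_pos (iotaK n m hnm k)).le
  have h3 : 64 / 7 / W m (iotaK n m hnm k) ≤ 64 / 7 / W n k :=
    div_le_div_of_nonneg_left (by norm_num) (by linarith) h2
  have h4 : 0 ≤ 64 / 7 / W m (iotaK n m hnm k) := div_nonneg (by norm_num) (by linarith)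
  exact mul_le_mul (mul_le_mul_of_nonneg_right h1 (by norm_num)) h3 h4 (by have := (cω_pos k).le; positivity)

/-- the summand `U_l/Δ_l²` of `X_{≠0}`. [folklore] -/
def XT (N : ℕ) [NeZero N] (k : Fin d → Fin N) (p : Fin d → ℂ) : ℂ := U N k p / DeltaXi N 0 (shift N k p) ^ 2

omit hn hnm hr hdr hp in
/-- `X_{≠0}` as the sum of `XT` over the non-zero aliases (definitional). [folklore] -/
theorem Xne_eq_sum (N : ℕ) [NeZero N] (p : Fin d → ℂ) :
    Xne N p = ∑ k ∈ univ.erase (fun _ => (0 : Fin N)), XT N k p := rfl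

/-- the constant of the `XT`-rate. [folklore] -/
def KX1 (d : ℕ) : ℝ := 2 * (64 / 7) * CD d + 16 * Cinv * (64 / 7) ^ 2 * ((d : ℝ) + 1) / 64

omit hn hnm hr hdr hp in
/-- `0 ≤ KX1`. [folklore] -/
theorem KX1_nonneg (d : ℕ) : 0 ≤ KX1 d := by unfold KX1; have := CD_nonneg d; have := Cinv_pos; positivity

/-- package of `U_l/Δ_l²` at a paired alias (`l ≠ 0`): bound `cω_n(l)(64/7)²/W_n(l)²`, rate `KX1(d)cω_n(l)/n²`. [folklore] -/
theorem XT_RB {k : Fin d → Fin n} (hk : k ≠ fun _ => 0) :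
    RB (XT m (iotaK n m hnm k) p) (XT n k p) (cω n k * (64 / 7 / W n k) * (64 / 7 / W n k))
      (KX1 d / (n : ℝ) ^ 2 * cω n k) := by
  have e1 : XT m (iotaK n m hnm k) p = U m (iotaK n m hnm k) p * (SW m n k p)⁻¹ * (SW m n k p)⁻¹ := by
    unfold XT; rw [DeltaXi_shift_iotaK_eq_SW]; ring
  have e2 : XT n k p = U n k p * (SW n n k p)⁻¹ * (SW n n k p)⁻¹ := by
    unfold XT; rw [DeltaXi_shift_eq_SW]; ring
  rw [e1, e2]
  have hD := SWinv_RB hn hnm hr hdr hp hk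
  have h := ((U_RB hn hnm hr hp k).mul hD).mul hD
  refine h.mono le_rfl ?_
  have hW := one_le_W n k hk
  have hc := (cω_pos k).le
  have hT0 : 0 ≤ ∑ ν, (64 / omega n (k ν) ^ 2)⁻¹ :=
    Finset.sum_nonneg (fun ν _ => by have := omega_pos n (k ν) (k ν).isLt; positivity)
  have hT := sum_inv_c_le hk
  have hCD := CD_nonneg d
  have hCi := Cinv_pos
  have hnr : (2 : ℝ) ≤ n := by exact_mod_cast hn
  set T := ∑ ν, (64 / omega n (k ν) ^ 2)⁻¹
  have hWpos : 0 < W n k := by linarith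
  set c := 64 / 7 / W n k with hc_def
  have hc0 : 0 ≤ c := div_nonneg (by norm_num) hWpos.le
  -- `T · c ≤ (d+1)(64/7)/64`
  have h1 : T * c ≤ ((d : ℝ) + 1) * (64 / 7) / 64 := by
    rw [hc_def, show T * (64 / 7 / W n k) = (64 * T) / W n k * ((64 / 7) / 64) by ring]
    have : 64 * T / W n k ≤ (d : ℝ) + 1 := by rw [div_le_iff₀ hWpos]; exact hT
    nlinarith
  have h2 : c ≤ 64 / 7 := div_le_self (by norm_num) hW
  have hρ := T4Rate166StripDirect.rho_nonneg n
  have hu : 0 ≤ CD d / (n : ℝ) ^ 2 := by positivity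
  have j1 : cω n k * c * (CD d / (n : ℝ) ^ 2) ≤ cω n k * (64 / 7) * (CD d / (n : ℝ) ^ 2) :=
    mul_le_mul_of_nonneg_right (mul_le_mul_of_nonneg_left h2 hc) hu
  have j2 : T4Rate166StripDirect.rho n * cω n k * T * c * c
      ≤ T4Rate166StripDirect.rho n * cω n k * (((d : ℝ) + 1) * (64 / 7) / 64) * (64 / 7) := by
    have i1 : T4Rate166StripDirect.rho n * cω n k * T * c
        ≤ T4Rate166StripDirect.rho n * cω n k * (((d : ℝ) + 1) * (64 / 7) / 64) := by
      rw [mul_assoc (T4Rate166StripDirect.rho n * cω n k)]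
      exact mul_le_mul_of_nonneg_left h1 (by positivity)
    exact mul_le_mul i1 h2 hc0 (by positivity)
  calc cω n k * c * (CD d / (n : ℝ) ^ 2)
        + (cω n k * (CD d / (n : ℝ) ^ 2) + T4Rate166StripDirect.rho n * cω n k * T * c) * c
      = cω n k * c * (CD d / (n : ℝ) ^ 2) + cω n k * c * (CD d / (n : ℝ) ^ 2)
        + T4Rate166StripDirect.rho n * cω n k * T * c * c := by ring
    _ ≤ cω n k * (64 / 7) * (CD d / (n : ℝ) ^ 2) + cω n k * (64 / 7) * (CD d / (n : ℝ) ^ 2)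
        + T4Rate166StripDirect.rho n * cω n k * (((d : ℝ) + 1) * (64 / 7) / 64) * (64 / 7) := by
        linarith [j1, j2]
    _ = KX1 d / (n : ℝ) ^ 2 * cω n k := by
        unfold KX1 T4Rate166StripDirect.rho; field_simp; ring

omit hn hnm in
/-- uniform bound of `U_l/Δ_l²` through King's weight (`l ≠ 0`): `‖XT‖ ≤ cω_N(l)(64/7)²/W_N(l)`. [folklore] -/
theorem norm_XT_le (N : ℕ) [NeZero N] {k : Fin d → Fin N} (hk : k ≠ fun _ => 0) :
    ‖XT N k p‖ ≤ cω N k * (64 / 7) ^ 2 / W N k := by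
  have hN : 1 ≤ N := Nat.one_le_iff_ne_zero.mpr (NeZero.ne N)
  have hW := one_le_W N k hk
  have h1 : ‖U N k p‖ ≤ cω N k := by
    rw [norm_U_eq]; unfold cω
    exact Finset.prod_le_prod (fun _ _ => norm_nonneg _)
      (fun ν _ => norm_uFactor_le_omega N hN (k ν).isLt (fat_re hr hp ν) (fat_im hr hp ν))
  have h3 : ‖(DeltaXi N 0 (shift N k p))⁻¹‖ ≤ 64 / 7 / W N k :=
    inv_le_of_W hW ((B4StripSums.re_DeltaXi_shift_ge_W N 0 le_rfl hr hdr hp k hk).trans (Complex.re_le_norm _))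
  unfold XT
  rw [div_eq_mul_inv, sq, mul_inv, norm_mul, norm_mul]
  have hc := (cω_pos k).le
  have h4 : 0 ≤ 64 / 7 / W N k := div_nonneg (by norm_num) (by linarith)
  have h5 : 64 / 7 / W N k ≤ 64 / 7 := div_le_self (by norm_num) hW
  calc ‖U N k p‖ * (‖(DeltaXi N 0 (shift N k p))⁻¹‖ * ‖(DeltaXi N 0 (shift N k p))⁻¹‖)
      ≤ cω N k * ((64 / 7 / W N k) * (64 / 7 / W N k)) :=
        mul_le_mul h1 (mul_le_mul h3 h3 (norm_nonneg _) h4) (by positivity) hc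
    _ ≤ cω N k * ((64 / 7 / W N k) * (64 / 7)) :=
        mul_le_mul_of_nonneg_left (mul_le_mul_of_nonneg_left h5 h4) hc
    _ = cω N k * (64 / 7) ^ 2 / W N k := by ring

omit [NeZero n] hnm in
/-- an UNPAIRED `X_{≠0}`-summand of level `m` is `O(n⁻²)`. [folklore] -/
theorem norm_XT_unpaired_le {k' : Fin d → Fin m} (hk : k' ≠ fun _ => 0) (hP : ¬ ∀ ν, Paired n m (k' ν)) :
    ‖XT m k' p‖ ≤ 4 * (64 / 7) ^ 2 / (n : ℝ) ^ 2 * cω m k' := by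
  obtain ⟨ν₀, hν₀⟩ := not_forall.mp hP
  have hω := le_two_omega_of_not_paired hν₀
  have hW := omega_sq_le_W m k' hk ν₀
  have hW1 := one_le_W m k' hk
  have h := norm_XT_le hr hdr hp m hk
  have hnr : (2 : ℝ) ≤ n := by exact_mod_cast hn
  have hn2 : (n : ℝ) ^ 2 ≤ 4 * W m k' := by nlinarith
  have hc := (cω_pos k').le
  have h4 : (64 / 7 : ℝ) ^ 2 / W m k' ≤ (64 / 7) ^ 2 * (4 / (n : ℝ) ^ 2) := by
    rw [div_eq_mul_inv]
    refine mul_le_mul_of_nonneg_left ?_ (by norm_num)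
    rw [inv_eq_one_div, div_le_div_iff₀ (by positivity) (by positivity)]
    linarith
  calc ‖XT m k' p‖ ≤ cω m k' * (64 / 7) ^ 2 / W m k' := h
    _ = cω m k' * ((64 / 7) ^ 2 / W m k') := by ring
    _ ≤ cω m k' * ((64 / 7) ^ 2 * (4 / (n : ℝ) ^ 2)) := mul_le_mul_of_nonneg_left h4 hc
    _ = 4 * (64 / 7) ^ 2 / (n : ℝ) ^ 2 * cω m k' := by ring

omit hn hr hdr hp in
/-- `X_{≠0}` at level `m` = (paired summands, re-indexed by level `n`) + (unpaired summands). [folklore] -/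
theorem Xne_split (p : Fin d → ℂ) :
    Xne m p = ∑ k ∈ univ.erase (fun _ => (0 : Fin n)), XT m (iotaK n m hnm k) p
      + ∑ k' ∈ (univ.erase (fun _ => (0 : Fin m))).filter (fun k' => ¬ ∀ ν, Paired n m (k' ν)), XT m k' p := by
  rw [Xne_eq_sum, ← Finset.sum_filter_add_sum_filter_not _ (fun k' : Fin d → Fin m => ∀ ν, Paired n m (k' ν)),
    filter_paired_eq_image hnm, Finset.sum_image]
  intro k₁ _ k₂ _ h
  exact iotaK_injective hnm h

/-- the constant of the `X_{≠0}`-rate. [folklore] -/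
def KX (d : ℕ) : ℝ := (KX1 d + 4 * (64 / 7) ^ 2) * 256 ^ d

omit hn hnm hr hdr hp in
/-- `0 ≤ KX`. [folklore] -/
theorem KX_nonneg (d : ℕ) : 0 ≤ KX d := by unfold KX; have := KX1_nonneg d; positivity

/-- **THE RATE OF `X_{≠0}`**: `‖X_m − X_n‖ ≤ KX(d)/n²`. [folklore] -/
theorem Xne_rate : ‖Xne m p - Xne n p‖ ≤ KX d / (n : ℝ) ^ 2 := by
  have hKX1 := KX1_nonneg d
  rw [Xne_split hnm, Xne_eq_sum n]
  have e : ∑ k ∈ univ.erase (fun _ => (0 : Fin n)), XT m (iotaK n m hnm k) p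
        + ∑ k' ∈ (univ.erase (fun _ => (0 : Fin m))).filter (fun k' => ¬ ∀ ν, Paired n m (k' ν)), XT m k' p
        - ∑ k ∈ univ.erase (fun _ => (0 : Fin n)), XT n k p
      = ∑ k ∈ univ.erase (fun _ => (0 : Fin n)), (XT m (iotaK n m hnm k) p - XT n k p)
        + ∑ k' ∈ (univ.erase (fun _ => (0 : Fin m))).filter (fun k' => ¬ ∀ ν, Paired n m (k' ν)), XT m k' p := by
    rw [Finset.sum_sub_distrib]; ring
  rw [e]
  calc _ ≤ ‖∑ k ∈ univ.erase (fun _ => (0 : Fin n)), (XT m (iotaK n m hnm k) p - XT n k p)‖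
        + ‖∑ k' ∈ (univ.erase (fun _ => (0 : Fin m))).filter (fun k' => ¬ ∀ ν, Paired n m (k' ν)), XT m k' p‖ :=
        norm_add_le _ _
    _ ≤ ∑ k ∈ univ.erase (fun _ => (0 : Fin n)), ‖XT m (iotaK n m hnm k) p - XT n k p‖
        + ∑ k' ∈ (univ.erase (fun _ => (0 : Fin m))).filter (fun k' => ¬ ∀ ν, Paired n m (k' ν)), ‖XT m k' p‖ :=
        add_le_add (norm_sum_le _ _) (norm_sum_le _ _)
    _ ≤ ∑ k ∈ univ.erase (fun _ => (0 : Fin n)), KX1 d / (n : ℝ) ^ 2 * cω n k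
        + ∑ k' ∈ (univ.erase (fun _ => (0 : Fin m))).filter (fun k' => ¬ ∀ ν, Paired n m (k' ν)),
            4 * (64 / 7) ^ 2 / (n : ℝ) ^ 2 * cω m k' := by
        refine add_le_add (Finset.sum_le_sum (fun k hk => ?_)) (Finset.sum_le_sum (fun k' hk' => ?_))
        · exact (XT_RB hn hnm hr hdr hp (Finset.mem_erase.mp hk).1).sub
        · have h1 := Finset.mem_filter.mp hk'
          exact norm_XT_unpaired_le hn hr hdr hp (Finset.mem_erase.mp h1.1).1 h1.2
    _ ≤ ∑ k : Fin d → Fin n, KX1 d / (n : ℝ) ^ 2 * cω n k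
        + ∑ k' : Fin d → Fin m, 4 * (64 / 7) ^ 2 / (n : ℝ) ^ 2 * cω m k' := by
        refine add_le_add ?_ ?_
        · exact Finset.sum_le_sum_of_subset_of_nonneg (Finset.erase_subset _ _)
            (fun k _ _ => by have := (cω_pos k).le; positivity)
        · exact Finset.sum_le_sum_of_subset_of_nonneg
            ((Finset.filter_subset _ _).trans (Finset.erase_subset _ _))
            (fun k _ _ => by have := (cω_pos k).le; positivity)
    _ = KX1 d / (n : ℝ) ^ 2 * ∑ k : Fin d → Fin n, cω n k
        + 4 * (64 / 7) ^ 2 / (n : ℝ) ^ 2 * ∑ k' : Fin d → Fin m, cω m k' := by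
        rw [← Finset.mul_sum, ← Finset.mul_sum]
    _ ≤ KX1 d / (n : ℝ) ^ 2 * 256 ^ d + 4 * (64 / 7) ^ 2 / (n : ℝ) ^ 2 * 256 ^ d :=
        add_le_add (mul_le_mul_of_nonneg_left (sum_cω_le n) (by positivity))
          (mul_le_mul_of_nonneg_left (sum_cω_le m) (by positivity))
    _ = KX d / (n : ℝ) ^ 2 := by unfold KX; ring

/-- package of `X_{≠0}`: bound `132^d/4`, rate `KX(d)/n²`. [folklore] -/
theorem Xne_RB : RB (Xne m p) (Xne n p) (132 ^ d / 4) (KX d / (n : ℝ) ^ 2) :=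
  ⟨B5Strip145Leaves.norm_Xne_le m hr hdr hp, B5Strip145Leaves.norm_Xne_le n hr hdr hp, Xne_rate hn hnm hr hdr hp⟩

/-- the constant of the `𝒩`-rate. [folklore] -/
def KNcal (d : ℕ) : ℝ := d * 4 ^ d * (16 * Cinv) + 2 * Bc d * KΔ d * (132 ^ d / 4) + Bc d ^ 2 * KX d

omit hn hnm hr hdr hp in
/-- `0 ≤ KNcal`. [folklore] -/
theorem KNcal_nonneg (d : ℕ) : 0 ≤ KNcal d := by
  unfold KNcal; have := Cinv_pos; have := Bc_pos d; have := KΔ_nonneg d; have := KX_nonneg d; positivity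

/-- the bound of `𝒩` used here. [folklore] -/
def BN (d : ℕ) : ℝ := 4 ^ d + Bc d * Bc d * (132 ^ d / 4)

/-- package of the regrouped numerator `𝒩 = U₀ + Δ₀²X_{≠0}`: bound `BN(d)`, rate `KNcal(d)/n²`. [folklore] -/
theorem Ncal_RB : RB (Ncal m p) (Ncal n p) (BN d) (KNcal d / (n : ℝ) ^ 2) := by
  have h := (U0_RB hn hnm hr hp).add
    (((DeltaXi0_RB hn hnm hr hp).mul (DeltaXi0_RB hn hnm hr hp)).mul (Xne_RB hn hnm hr hdr hp))
  have e1 : Ncal m p = U m (fun _ => 0) p + DeltaXi m 0 p * DeltaXi m 0 p * Xne m p := by unfold Ncal; ring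
  have e2 : Ncal n p = U n (fun _ => 0) p + DeltaXi n 0 p * DeltaXi n 0 p * Xne n p := by unfold Ncal; ring
  rw [e1, e2]
  refine h.mono (le_of_eq (by unfold BN; ring)) (le_of_eq ?_)
  unfold KNcal T4Rate166StripDirect.rho; ring

end Paired

/-! ### §3.4 Packages of the inner alias sum

Currency (paired alias `l = ι l₀`, `l₀ ≠ 0`, direction `μ`): `t = W_n(l₀)⁻¹`, `s = ω_n(l₀μ)⁻²`, `u = n⁻²`; every term of the
closed form of §3.2 has bound `≤ β·t(t+s)` and rate `≤ κ·u(t+s)`. -/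

/-- the closed form of §3.2 in product form (`l ≠ 0`). [folklore] -/
theorem sum_Afac_eq' (N : ℕ) [NeZero N] (μ : Fin d) {K : Fin d → Fin N} (hK : K ≠ fun _ => 0)
    (p : Fin d → ℂ) :
    ∑ k' ∈ univ.erase K, B5Hk163Strip.Afac N μ K k' p
      = U N (fun _ => 0) p * uFactor N 0 (p μ) * B5Hk163Strip.rho N K p * (DeltaXi N 0 (shift N K p))⁻¹
        - U N (fun _ => 0) p * uFactor N (K μ : ℕ) (p μ) * (DeltaXi N 0 (shift N K p))⁻¹
        + B5Hk163Strip.rho N K p * B5Hk163Strip.rho N K p * (Rt N μ p - T166 N μ K p)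
        - uFactor N (K μ : ℕ) (p μ) * (DeltaXi N 0 (shift N K p))⁻¹ * (DeltaXi N 0 p * DeltaXi N 0 p)
            * (Xne N p - XT N K p) := by
  rw [sum_Afac_eq N μ hK p]
  unfold XT B5Hk163Strip.rho
  rw [if_neg hK]
  ring

/-- bound constant of term A. [folklore] -/
def βA (d : ℕ) : ℝ := 4 ^ d * 4 * Bc d * (64 / 7) ^ 2

/-- rate constant of term A. [folklore] -/
def κA (d : ℕ) : ℝ := 4 ^ d * 4 * Bc d * (64 / 7) * CD d + 4 ^ d * 4 * Krho d * (64 / 7)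
    + (4 ^ d * (16 * Cinv) + d * 4 ^ d * (16 * Cinv) * 4) * Bc d * (64 / 7) ^ 2

/-- bound constant of term B. [folklore] -/
def βB (d : ℕ) : ℝ := 4 ^ d * 64 * (64 / 7)

/-- rate constant of term B. [folklore] -/
def κB (d : ℕ) : ℝ := 4 ^ d * 64 * CD d + 4 ^ d * (16 * Cinv) * (64 / 7) + d * 4 ^ d * (16 * Cinv) * 64 * (64 / 7)

/-- bound of `R̃ − T(l)`. [folklore] -/
def BRT (d : ℕ) : ℝ := Bc d + 64 ^ d * 64 * (64 / 7)

/-- bound constant of term C. [folklore] -/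
def βC (d : ℕ) : ℝ := Bc d ^ 2 * (64 / 7) ^ 2 * BRT d

/-- rate constant of term C. [folklore] -/
def κC (d : ℕ) : ℝ := Bc d ^ 2 * (64 / 7) ^ 2 * (KR d + KT d * 64 ^ d) + 2 * Bc d * (64 / 7) * Krho d * BRT d

/-- bound of `X_{≠0} − U_l/Δ_l²`. [folklore] -/
def bX (d : ℕ) : ℝ := 132 ^ d / 4 + 64 ^ d * (64 / 7) ^ 2

/-- bound constant of term D. [folklore] -/
def βD (d : ℕ) : ℝ := 64 * (64 / 7) * Bc d ^ 2 * bX d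

/-- rate constant of term D. [folklore] -/
def κD (d : ℕ) : ℝ := 64 * (64 / 7) * Bc d ^ 2 * (KX d + KX1 d * 64 ^ d) + 64 * (64 / 7) * (2 * Bc d * KΔ d) * bX d
    + 64 * CD d * Bc d ^ 2 * bX d + 16 * Cinv * (64 / 7) * Bc d ^ 2 * bX d

/-- **bound constant of the inner alias sum**. [folklore] -/
def BS (d : ℕ) : ℝ := βA d + βB d + βC d + βD d

/-- **rate constant of the inner alias sum**. [folklore] -/
def KS (d : ℕ) : ℝ := κA d + κB d + κC d + κD d

/-- `0 ≤ BS`. [folklore] -/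
theorem BS_nonneg (d : ℕ) : 0 ≤ BS d := by
  unfold BS βA βB βC βD BRT bX; have := Bc_pos d; positivity

/-- `0 ≤ KS`. [folklore] -/
theorem KS_nonneg (d : ℕ) : 0 ≤ KS d := by
  unfold KS κA κB κC κD BRT bX
  have := Bc_pos d; have := CD_nonneg d; have := Krho_nonneg d; have := Cinv_pos; have := KR_nonneg d
  have := KT_nonneg d; have := KX_nonneg d; have := KX1_nonneg d; have := KΔ_nonneg d
  positivity

section SA

variable {n m : ℕ} [NeZero n] [NeZero m] (hn : 2 ≤ n) (hnm : n ≤ m) {r : ℝ} (hr : r ≤ 1 / 4)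
  (hdr : (d : ℝ) * r ^ 2 ≤ 1 / 16) {p : Fin d → ℂ} (hp : p ∈ Fat d r)
include hn hnm hr hdr hp

/-- term A `U₀u₀ρ_lΔ_l⁻¹`. [folklore] -/
theorem termA_RB {k : Fin d → Fin n} (hk : k ≠ fun _ => 0) (μ : Fin d) :
    RB (U m (fun _ => 0) p * uFactor m 0 (p μ) * B5Hk163Strip.rho m (iotaK n m hnm k) p * (SW m n k p)⁻¹)
      (U n (fun _ => 0) p * uFactor n 0 (p μ) * B5Hk163Strip.rho n k p * (SW n n k p)⁻¹)
      (βA d * ((W n k)⁻¹ * ((W n k)⁻¹ + (omega n (k μ) ^ 2)⁻¹)))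
      (κA d * (((n : ℝ) ^ 2)⁻¹ * ((W n k)⁻¹ + (omega n (k μ) ^ 2)⁻¹))) := by
  have hx := fat_re hr hp μ
  have hy := fat_im hr hp μ
  have hW := one_le_W n k hk
  have h := (((U0_RB hn hnm hr hp).mul (uFactor_zero_RB hn hnm hx hy)).mul (rho_RB hn hnm hr hdr hp hk)).mul
    (SWinv_RB hn hnm hr hdr hp hk)
  have ht0 : 0 ≤ (W n k)⁻¹ := inv_nonneg.mpr (by linarith)
  have ht1 : (W n k)⁻¹ ≤ 1 := inv_le_one_of_one_le₀ hW
  have hs0 : 0 ≤ (omega n (k μ) ^ 2)⁻¹ := by have := omega_pos n _ (k μ).isLt; positivity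
  have hu0 : 0 ≤ ((n : ℝ) ^ 2)⁻¹ := by positivity
  have hBc := Bc_pos d; have hCD := CD_nonneg d; have hKr := Krho_nonneg d; have hCi := Cinv_pos
  refine h.mono ?_ ?_ <;> simp only [T4Rate166StripDirect.rho, div_eq_mul_inv] <;>
    generalize (W n k)⁻¹ = t at ht0 ht1 ⊢ <;> generalize (omega n (k μ) ^ 2)⁻¹ = s at hs0 ⊢ <;>
    generalize ((n : ℝ) ^ 2)⁻¹ = u at hu0 ⊢
  · have hts : 0 ≤ t * s := by positivity
    have c1 : 0 ≤ βA d := by unfold βA; positivity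
    have e : (4 : ℝ) ^ d * 4 * (Bc d * (64 * 7⁻¹ * t)) * (64 * 7⁻¹ * t) = βA d * (t * t) := by unfold βA; ring
    rw [e]
    nlinarith [mul_nonneg c1 hts]
  · have hus : 0 ≤ u * s := by positivity
    have h1t : 0 ≤ 1 - t := by linarith
    have hA1 : 0 ≤ u * t * (1 - t) := by positivity
    unfold κA
    nlinarith [mul_nonneg (by positivity : (0 : ℝ) ≤ 4 ^ d * 4 * Bc d * (64 / 7) * CD d) hus,
      mul_nonneg (by positivity : (0 : ℝ) ≤ 4 ^ d * 4 * Krho d * (64 / 7)) hus,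
      mul_nonneg (by positivity : (0 : ℝ) ≤ (4 ^ d * (16 * Cinv) + d * 4 ^ d * (16 * Cinv) * 4) * Bc d * (64 / 7) ^ 2) hus,
      mul_nonneg (by positivity : (0 : ℝ) ≤ (4 ^ d * (16 * Cinv) + d * 4 ^ d * (16 * Cinv) * 4) * Bc d * (64 / 7) ^ 2) hA1]

/-- term B `U₀u(l_μ)Δ_l⁻¹`. [folklore] -/
theorem termB_RB {k : Fin d → Fin n} (hk : k ≠ fun _ => 0) (μ : Fin d) :
    RB (U m (fun _ => 0) p * uFactor m (iota n m (k μ)) (p μ) * (SW m n k p)⁻¹)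
      (U n (fun _ => 0) p * uFactor n (k μ) (p μ) * (SW n n k p)⁻¹)
      (βB d * ((W n k)⁻¹ * ((W n k)⁻¹ + (omega n (k μ) ^ 2)⁻¹)))
      (κB d * (((n : ℝ) ^ 2)⁻¹ * ((W n k)⁻¹ + (omega n (k μ) ^ 2)⁻¹))) := by
  have hx := fat_re hr hp μ
  have hy := fat_im hr hp μ
  have hW := one_le_W n k hk
  have hω := one_le_omega n _ (k μ).isLt
  have h := ((U0_RB hn hnm hr hp).mul (uFactor_RB hn hnm (k μ).isLt hx hy)).mul (SWinv_RB hn hnm hr hdr hp hk)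
  have ht0 : 0 ≤ (W n k)⁻¹ := inv_nonneg.mpr (by linarith)
  have ht1 : (W n k)⁻¹ ≤ 1 := inv_le_one_of_one_le₀ hW
  have hs0 : 0 ≤ (omega n (k μ) ^ 2)⁻¹ := by have := omega_pos n _ (k μ).isLt; positivity
  have hs1 : (omega n (k μ) ^ 2)⁻¹ ≤ 1 := inv_le_one_of_one_le₀ (one_le_pow₀ hω)
  have hu0 : 0 ≤ ((n : ℝ) ^ 2)⁻¹ := by positivity
  have hBc := Bc_pos d; have hCD := CD_nonneg d; have hCi := Cinv_pos
  refine h.mono ?_ ?_ <;> simp only [T4Rate166StripDirect.rho, div_eq_mul_inv] <;>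
    generalize (W n k)⁻¹ = t at ht0 ht1 ⊢ <;> generalize (omega n (k μ) ^ 2)⁻¹ = s at hs0 hs1 ⊢ <;>
    generalize ((n : ℝ) ^ 2)⁻¹ = u at hu0 ⊢
  · have htt : 0 ≤ t * t := by positivity
    have c1 : 0 ≤ βB d := by unfold βB; positivity
    have e : (4 : ℝ) ^ d * (64 * s) * (64 * 7⁻¹ * t) = βB d * (s * t) := by unfold βB; ring
    rw [e]
    nlinarith [mul_nonneg c1 htt]
  · have hus : 0 ≤ u * s := by positivity
    have hut : 0 ≤ u * t := by positivity
    have h1s : 0 ≤ 1 - s := by linarith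
    have hB1 : 0 ≤ u * t * (1 - s) := by positivity
    unfold κB
    nlinarith [mul_nonneg (by positivity : (0 : ℝ) ≤ 4 ^ d * 64 * CD d) hut,
      mul_nonneg (by positivity : (0 : ℝ) ≤ 4 ^ d * (16 * Cinv) * (64 / 7)) hus,
      mul_nonneg (by positivity : (0 : ℝ) ≤ d * 4 ^ d * (16 * Cinv) * 64 * (64 / 7)) hus,
      mul_nonneg (by positivity : (0 : ℝ) ≤ d * 4 ^ d * (16 * Cinv) * 64 * (64 / 7)) hB1]

/-- package of `R̃ − T(l)` with constant bound. [folklore] -/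
theorem RtT_RB {k : Fin d → Fin n} (hk : k ≠ fun _ => 0) (μ : Fin d) :
    RB (Rt m μ p - T166 m μ (iotaK n m hnm k) p) (Rt n μ p - T166 n μ k p) (BRT d)
      ((KR d + KT d * 64 ^ d) * ((n : ℝ) ^ 2)⁻¹) := by
  have hW := one_le_W n k hk
  have hc := cω_le n k
  have hc0 := (cω_pos k).le
  have hT := T166K_RB hn hnm hr hdr hp hk μ
  have ht1 : 64 / 7 / W n k ≤ 64 / 7 := div_le_self (by norm_num) hW
  have ht0 : 0 ≤ 64 / 7 / W n k := div_nonneg (by norm_num) (by linarith)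
  have hT' : RB (T166 m μ (iotaK n m hnm k) p) (T166 n μ k p) (64 ^ d * 64 * (64 / 7))
      (KT d * 64 ^ d * ((n : ℝ) ^ 2)⁻¹) := by
    refine hT.mono ?_ ?_
    · exact mul_le_mul (mul_le_mul_of_nonneg_right hc (by norm_num)) ht1 ht0 (by positivity)
    · rw [div_eq_mul_inv]
      have := KT_nonneg d
      calc KT d * ((n : ℝ) ^ 2)⁻¹ * cω n k ≤ KT d * ((n : ℝ) ^ 2)⁻¹ * 64 ^ d :=
            mul_le_mul_of_nonneg_left hc (by positivity)
        _ = KT d * 64 ^ d * ((n : ℝ) ^ 2)⁻¹ := by ring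
  have h := RB_sub (Rt_RB hn hnm hr hdr hp μ) hT'
  refine h.mono (le_of_eq (by unfold BRT; ring)) (le_of_eq (by rw [div_eq_mul_inv]; ring))

/-- term C `ρ_l²(R̃ − T(l))`. [folklore] -/
theorem termC_RB {k : Fin d → Fin n} (hk : k ≠ fun _ => 0) (μ : Fin d) :
    RB (B5Hk163Strip.rho m (iotaK n m hnm k) p * B5Hk163Strip.rho m (iotaK n m hnm k) p
          * (Rt m μ p - T166 m μ (iotaK n m hnm k) p))
      (B5Hk163Strip.rho n k p * B5Hk163Strip.rho n k p * (Rt n μ p - T166 n μ k p))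
      (βC d * ((W n k)⁻¹ * ((W n k)⁻¹ + (omega n (k μ) ^ 2)⁻¹)))
      (κC d * (((n : ℝ) ^ 2)⁻¹ * ((W n k)⁻¹ + (omega n (k μ) ^ 2)⁻¹))) := by
  have hW := one_le_W n k hk
  have hρ := rho_RB hn hnm hr hdr hp hk
  have h := (hρ.mul hρ).mul (RtT_RB hn hnm hr hdr hp hk μ)
  have ht0 : 0 ≤ (W n k)⁻¹ := inv_nonneg.mpr (by linarith)
  have ht1 : (W n k)⁻¹ ≤ 1 := inv_le_one_of_one_le₀ hW
  have hs0 : 0 ≤ (omega n (k μ) ^ 2)⁻¹ := by have := omega_pos n _ (k μ).isLt; positivity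
  have hu0 : 0 ≤ ((n : ℝ) ^ 2)⁻¹ := by positivity
  have hBc := Bc_pos d; have hKr := Krho_nonneg d; have hKR := KR_nonneg d; have hKT := KT_nonneg d
  have hBRT : 0 ≤ BRT d := by unfold BRT; positivity
  refine h.mono ?_ ?_ <;> simp only [div_eq_mul_inv] <;>
    generalize (W n k)⁻¹ = t at ht0 ht1 ⊢ <;> generalize (omega n (k μ) ^ 2)⁻¹ = s at hs0 ⊢ <;>
    generalize ((n : ℝ) ^ 2)⁻¹ = u at hu0 ⊢
  · have hts : 0 ≤ t * s := by positivity
    have c1 : 0 ≤ βC d := by unfold βC; positivity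
    have e : Bc d * (64 * 7⁻¹ * t) * (Bc d * (64 * 7⁻¹ * t)) * BRT d = βC d * (t * t) := by unfold βC; ring
    rw [e]
    nlinarith [mul_nonneg c1 hts]
  · have hus : 0 ≤ u * s := by positivity
    have h1t : 0 ≤ 1 - t := by linarith
    have hA1 : 0 ≤ u * t * (1 - t) := by positivity
    unfold κC
    nlinarith [mul_nonneg (by positivity : (0 : ℝ) ≤ Bc d ^ 2 * (64 / 7) ^ 2 * (KR d + KT d * 64 ^ d)) hus,
      mul_nonneg (by positivity : (0 : ℝ) ≤ Bc d ^ 2 * (64 / 7) ^ 2 * (KR d + KT d * 64 ^ d)) hA1,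
      mul_nonneg (by positivity : (0 : ℝ) ≤ 2 * Bc d * (64 / 7) * Krho d * BRT d) hus]

/-- package of `X_{≠0} − U_l/Δ_l²` with constant bound. [folklore] -/
theorem XXT_RB {k : Fin d → Fin n} (hk : k ≠ fun _ => 0) :
    RB (Xne m p - XT m (iotaK n m hnm k) p) (Xne n p - XT n k p) (bX d)
      ((KX d + KX1 d * 64 ^ d) * ((n : ℝ) ^ 2)⁻¹) := by
  have hW := one_le_W n k hk
  have hc := cω_le n k
  have hc0 := (cω_pos k).le
  have hXT := XT_RB hn hnm hr hdr hp hk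
  have ht1 : 64 / 7 / W n k ≤ 64 / 7 := div_le_self (by norm_num) hW
  have ht0 : 0 ≤ 64 / 7 / W n k := div_nonneg (by norm_num) (by linarith)
  have hXT' : RB (XT m (iotaK n m hnm k) p) (XT n k p) (64 ^ d * (64 / 7) ^ 2)
      (KX1 d * 64 ^ d * ((n : ℝ) ^ 2)⁻¹) := by
    refine hXT.mono ?_ ?_
    · rw [sq, ← mul_assoc]
      exact mul_le_mul (mul_le_mul hc ht1 ht0 (by positivity)) ht1 ht0 (by positivity)
    · rw [div_eq_mul_inv]
      have := KX1_nonneg d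
      calc KX1 d * ((n : ℝ) ^ 2)⁻¹ * cω n k ≤ KX1 d * ((n : ℝ) ^ 2)⁻¹ * 64 ^ d :=
            mul_le_mul_of_nonneg_left hc (by positivity)
        _ = KX1 d * 64 ^ d * ((n : ℝ) ^ 2)⁻¹ := by ring
  have h := RB_sub (Xne_RB hn hnm hr hdr hp) hXT'
  refine h.mono (le_of_eq (by unfold bX; ring)) (le_of_eq (by rw [div_eq_mul_inv]; ring))

/-- term D `u(l_μ)Δ_l⁻¹Δ₀²(X_{≠0} − U_l/Δ_l²)`. [folklore] -/
theorem termD_RB {k : Fin d → Fin n} (hk : k ≠ fun _ => 0) (μ : Fin d) :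
    RB (uFactor m (iota n m (k μ)) (p μ) * (SW m n k p)⁻¹ * (DeltaXi m 0 p * DeltaXi m 0 p)
          * (Xne m p - XT m (iotaK n m hnm k) p))
      (uFactor n (k μ) (p μ) * (SW n n k p)⁻¹ * (DeltaXi n 0 p * DeltaXi n 0 p) * (Xne n p - XT n k p))
      (βD d * ((W n k)⁻¹ * ((W n k)⁻¹ + (omega n (k μ) ^ 2)⁻¹)))
      (κD d * (((n : ℝ) ^ 2)⁻¹ * ((W n k)⁻¹ + (omega n (k μ) ^ 2)⁻¹))) := by
  have hx := fat_re hr hp μ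
  have hy := fat_im hr hp μ
  have hW := one_le_W n k hk
  have hω := one_le_omega n _ (k μ).isLt
  have hΔ := DeltaXi0_RB hn hnm hr hp
  have h := (((uFactor_RB hn hnm (k μ).isLt hx hy).mul (SWinv_RB hn hnm hr hdr hp hk)).mul (hΔ.mul hΔ)).mul
    (XXT_RB hn hnm hr hdr hp hk)
  have ht0 : 0 ≤ (W n k)⁻¹ := inv_nonneg.mpr (by linarith)
  have ht1 : (W n k)⁻¹ ≤ 1 := inv_le_one_of_one_le₀ hW
  have hs0 : 0 ≤ (omega n (k μ) ^ 2)⁻¹ := by have := omega_pos n _ (k μ).isLt; positivity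
  have hs1 : (omega n (k μ) ^ 2)⁻¹ ≤ 1 := inv_le_one_of_one_le₀ (one_le_pow₀ hω)
  have hu0 : 0 ≤ ((n : ℝ) ^ 2)⁻¹ := by positivity
  have hBc := Bc_pos d; have hCD := CD_nonneg d; have hCi := Cinv_pos; have hKΔ := KΔ_nonneg d
  have hKX := KX_nonneg d; have hKX1 := KX1_nonneg d
  have hbX : 0 ≤ bX d := by unfold bX; positivity
  refine h.mono ?_ ?_ <;> simp only [T4Rate166StripDirect.rho, div_eq_mul_inv] <;>
    generalize (W n k)⁻¹ = t at ht0 ht1 ⊢ <;> generalize (omega n (k μ) ^ 2)⁻¹ = s at hs0 hs1 ⊢ <;>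
    generalize ((n : ℝ) ^ 2)⁻¹ = u at hu0 ⊢
  · have htt : 0 ≤ t * t := by positivity
    have c1 : 0 ≤ βD d := by unfold βD; positivity
    have e : 64 * s * (64 * 7⁻¹ * t) * (Bc d * Bc d) * bX d = βD d * (s * t) := by unfold βD; ring
    rw [e]
    nlinarith [mul_nonneg c1 htt]
  · have hus : 0 ≤ u * s := by positivity
    have hut : 0 ≤ u * t := by positivity
    have h1s : 0 ≤ 1 - s := by linarith
    have hB1 : 0 ≤ u * t * (1 - s) := by positivity
    unfold κD
    nlinarith [mul_nonneg (by positivity : (0 : ℝ) ≤ 64 * (64 / 7) * Bc d ^ 2 * (KX d + KX1 d * 64 ^ d)) hus,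
      mul_nonneg (by positivity : (0 : ℝ) ≤ 64 * (64 / 7) * Bc d ^ 2 * (KX d + KX1 d * 64 ^ d)) hB1,
      mul_nonneg (by positivity : (0 : ℝ) ≤ 64 * (64 / 7) * (2 * Bc d * KΔ d) * bX d) hus,
      mul_nonneg (by positivity : (0 : ℝ) ≤ 64 * (64 / 7) * (2 * Bc d * KΔ d) * bX d) hB1,
      mul_nonneg (by positivity : (0 : ℝ) ≤ 64 * CD d * Bc d ^ 2 * bX d) hut,
      mul_nonneg (by positivity : (0 : ℝ) ≤ 16 * Cinv * (64 / 7) * Bc d ^ 2 * bX d) hus]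

/-- **PACKAGE OF THE INNER ALIAS SUM** at a paired alias `l = ι l₀`, `l₀ ≠ 0`: bound `BS·t(t+s)`, rate `KS·u(t+s)`
(`t = W_n(l₀)⁻¹`, `s = ω_n(l₀μ)⁻²`, `u = n⁻²`). [folklore] -/
theorem SA_RB {k : Fin d → Fin n} (hk : k ≠ fun _ => 0) (μ : Fin d) :
    RB (∑ k' ∈ univ.erase (iotaK n m hnm k), B5Hk163Strip.Afac m μ (iotaK n m hnm k) k' p)
      (∑ k' ∈ univ.erase k, B5Hk163Strip.Afac n μ k k' p)
      (BS d * ((W n k)⁻¹ * ((W n k)⁻¹ + (omega n (k μ) ^ 2)⁻¹)))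
      (KS d * (((n : ℝ) ^ 2)⁻¹ * ((W n k)⁻¹ + (omega n (k μ) ^ 2)⁻¹))) := by
  have em := sum_Afac_eq' m μ (iotaK_ne_zero hnm hk) p
  rw [DeltaXi_shift_iotaK_eq_SW, iotaK_val] at em
  have en := sum_Afac_eq' n μ hk p
  rw [DeltaXi_shift_eq_SW] at en
  rw [em, en]
  have h := RB_sub (((RB_sub (termA_RB hn hnm hr hdr hp hk μ) (termB_RB hn hnm hr hdr hp hk μ)).add
    (termC_RB hn hnm hr hdr hp hk μ))) (termD_RB hn hnm hr hdr hp hk μ)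
  exact h.mono (le_of_eq (by unfold BS; ring)) (le_of_eq (by unfold KS; ring))

/-- bound of the inner alias sum at the ZERO alias. [folklore] -/
def BS0 (d : ℕ) : ℝ := Bc d + 4 * Bc d * (132 ^ d / 4)

/-- rate constant of the inner alias sum at the ZERO alias. [folklore] -/
def KS0 (d : ℕ) : ℝ := KR d + (4 * KΔ d + 16 * Cinv * Bc d) * (132 ^ d / 4) + 4 * Bc d * KX d

omit hn hnm hr hdr hp in
/-- `0 ≤ KS0`. [folklore] -/
theorem KS0_nonneg (d : ℕ) : 0 ≤ KS0 d := by
  unfold KS0; have := Bc_pos d; have := KR_nonneg d; have := KΔ_nonneg d; have := Cinv_pos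
  have := KX_nonneg d; positivity

/-- **PACKAGE OF THE INNER ALIAS SUM AT THE ZERO ALIAS**: bound `BS0`, rate `KS0/n²`. [folklore] -/
theorem SA0_RB (μ : Fin d) :
    RB (∑ k' ∈ univ.erase (fun _ => (0 : Fin m)), B5Hk163Strip.Afac m μ (fun _ => 0) k' p)
      (∑ k' ∈ univ.erase (fun _ => (0 : Fin n)), B5Hk163Strip.Afac n μ (fun _ => 0) k' p)
      (BS0 d) (KS0 d * ((n : ℝ) ^ 2)⁻¹) := by
  have hx := fat_re hr hp μ
  have hy := fat_im hr hp μ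
  rw [sum_Afac_zero_eq, sum_Afac_zero_eq]
  have h := RB_sub (Rt_RB hn hnm hr hdr hp μ)
    (((uFactor_zero_RB hn hnm hx hy).mul (DeltaXi0_RB hn hnm hr hp)).mul (Xne_RB hn hnm hr hdr hp))
  refine h.mono (le_of_eq (by unfold BS0; ring)) (le_of_eq ?_)
  unfold KS0 T4Rate166StripDirect.rho; simp only [div_eq_mul_inv]; ring

end SA

/-! ### §3.5 Normal form, monomial weights and the packages of `h_{l;μλ}`

CURRENCY of the final packages (paired alias `l = ι l₀`, `l₀ ≠ 0`): bound `β·Y`, rate `κ·(n⁻¹·X)` with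
`Y = Pom_n(l₀)·W_n(l₀)⁻¹ ≤ X = prof_n(l₀) = Pom_n(l₀)·W_n(l₀)^{−1/2}`; at the zero alias `X = Y = 1`. -/

/-- `K/n² ≤ K·n⁻¹` (`n ≥ 1`, `K ≥ 0`). [folklore] -/
theorem div_sq_le_mul_inv {K : ℝ} (hK : 0 ≤ K) {n : ℕ} (hn : 1 ≤ n) :
    K / (n : ℝ) ^ 2 ≤ K * ((n : ℝ))⁻¹ := by
  have hn1 : (1 : ℝ) ≤ n := by exact_mod_cast hn
  have hi : ((n : ℝ))⁻¹ ≤ 1 := inv_le_one_of_one_le₀ hn1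
  have hi0 : 0 ≤ ((n : ℝ))⁻¹ := by positivity
  rw [div_eq_mul_inv, sq, mul_inv]
  calc K * (((n : ℝ))⁻¹ * ((n : ℝ))⁻¹) ≤ K * (((n : ℝ))⁻¹ * 1) :=
        mul_le_mul_of_nonneg_left (mul_le_mul_of_nonneg_left hi hi0) hK
    _ = K * ((n : ℝ))⁻¹ := by ring

/-- NORMAL-FORM PRODUCT RULE: a package with bound `β·Y` and rate `κ·(ν·X)` (`0 ≤ Y ≤ X`) times a package whose
rate is `≤ K·ν` is again of that form. [folklore] -/
theorem RB_nmul {a b a' b' : ℂ} {β κ X Y ν B' ρ' K : ℝ} (h : RB a b (β * Y) (κ * (ν * X))) (h' : RB a' b' B' ρ')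
    (hρ' : ρ' ≤ K * ν) (hY : 0 ≤ Y) (hYX : Y ≤ X) (hβ : 0 ≤ β) :
    RB (a * a') (b * b') (β * B' * Y) ((β * K + κ * B') * (ν * X)) := by
  refine (h.mul h').mono (le_of_eq (by ring)) ?_
  have hX : 0 ≤ X := hY.trans hYX
  have h1 : β * Y * ρ' ≤ β * X * (K * ν) :=
    mul_le_mul (mul_le_mul_of_nonneg_left hYX hβ) hρ' h'.ρ_nonneg (mul_nonneg hβ hX)
  calc β * Y * ρ' + κ * (ν * X) * B' ≤ β * X * (K * ν) + κ * (ν * X) * B' := by linarith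
    _ = (β * K + κ * B') * (ν * X) := by ring

/-- NORMAL-FORM QUOTIENT RULE. [folklore] -/
theorem RB_ndiv {a b a' b' : ℂ} {β κ X Y ν B' ρ' K c₀ : ℝ} (hc : 0 < c₀) (h : RB a b (β * Y) (κ * (ν * X)))
    (h' : RB a' b' B' ρ') (hρ' : ρ' ≤ K * ν) (ha' : c₀ ≤ ‖a'‖) (hb' : c₀ ≤ ‖b'‖) (hY : 0 ≤ Y) (hYX : Y ≤ X)
    (hβ : 0 ≤ β) :
    RB (a / a') (b / b') (β / c₀ * Y) ((κ / c₀ + β * K / c₀ ^ 2) * (ν * X)) := by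
  refine (RB_div hc h h' ha' hb').mono (le_of_eq (by ring)) ?_
  have hX : 0 ≤ X := hY.trans hYX
  have h1 : β * Y * ρ' ≤ β * X * (K * ν) :=
    mul_le_mul (mul_le_mul_of_nonneg_left hYX hβ) hρ' h'.ρ_nonneg (mul_nonneg hβ hX)
  have h2 : β * Y * ρ' / c₀ ^ 2 ≤ β * X * (K * ν) / c₀ ^ 2 := div_le_div_of_nonneg_right h1 (by positivity)
  calc κ * (ν * X) / c₀ + β * Y * ρ' / c₀ ^ 2 ≤ κ * (ν * X) / c₀ + β * X * (K * ν) / c₀ ^ 2 := by linarith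
    _ = (κ / c₀ + β * K / c₀ ^ 2) * (ν * X) := by ring

/-- the unit package. [folklore] -/
theorem RB_one : RB (1 : ℂ) 1 1 0 := ⟨by simp, by simp, by simp⟩

/-- MONOMIAL WEIGHT 1: `ω·(t(t+s)) ≤ 2t` (`t = sW⁻²`, `s = ω⁻²`, `1 ≤ ω ≤ sW`). [folklore] -/
theorem omega_mul_tt_le {ω sW : ℝ} (hω : 1 ≤ ω) (hωs : ω ≤ sW) :
    ω * ((sW ^ 2)⁻¹ * ((sW ^ 2)⁻¹ + (ω ^ 2)⁻¹)) ≤ 2 * (sW ^ 2)⁻¹ := by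
  have hsW : 1 ≤ sW := hω.trans hωs
  have hω0 : 0 < ω := by linarith
  have hs0 : 0 < sW := by linarith
  have h1 : ω ≤ sW ^ 2 := hωs.trans (by nlinarith)
  rw [← sub_nonneg]
  have e : 2 * (sW ^ 2)⁻¹ - ω * ((sW ^ 2)⁻¹ * ((sW ^ 2)⁻¹ + (ω ^ 2)⁻¹))
      = (2 * ω * sW ^ 2 - ω ^ 2 - sW ^ 2) / (ω * sW ^ 4) := by
    field_simp; ring
  rw [e]
  exact div_nonneg (by nlinarith [mul_le_mul_of_nonneg_left h1 hω0.le, mul_nonneg (by linarith : (0 : ℝ) ≤ ω - 1) (sq_nonneg sW)]) (by positivity)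

/-- MONOMIAL WEIGHT 2: `ω·(t+s) ≤ 2`. [folklore] -/
theorem omega_mul_ts_le {ω sW : ℝ} (hω : 1 ≤ ω) (hωs : ω ≤ sW) :
    ω * ((sW ^ 2)⁻¹ + (ω ^ 2)⁻¹) ≤ 2 := by
  have hsW : 1 ≤ sW := hω.trans hωs
  have hω0 : 0 < ω := by linarith
  have hs0 : 0 < sW := by linarith
  have h1 : ω ≤ sW ^ 2 := hωs.trans (by nlinarith)
  rw [← sub_nonneg]
  have e : 2 - ω * ((sW ^ 2)⁻¹ + (ω ^ 2)⁻¹) = (2 * ω * sW ^ 2 - ω ^ 2 - sW ^ 2) / (ω * sW ^ 2) := by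
    field_simp; ring
  rw [e]
  exact div_nonneg (by nlinarith [mul_le_mul_of_nonneg_left h1 hω0.le, mul_nonneg (by linarith : (0 : ℝ) ≤ ω - 1) (sq_nonneg sW)]) (by positivity)

/-- MONOMIAL WEIGHT 3: `ω²·(t(t+s)) ≤ 2t`. [folklore] -/
theorem omega_sq_mul_tt_le {ω sW : ℝ} (hω : 1 ≤ ω) (hωs : ω ≤ sW) :
    ω ^ 2 * ((sW ^ 2)⁻¹ * ((sW ^ 2)⁻¹ + (ω ^ 2)⁻¹)) ≤ 2 * (sW ^ 2)⁻¹ := by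
  have hsW : 1 ≤ sW := hω.trans hωs
  have hω0 : 0 < ω := by linarith
  have hs0 : 0 < sW := by linarith
  rw [← sub_nonneg]
  have e : 2 * (sW ^ 2)⁻¹ - ω ^ 2 * ((sW ^ 2)⁻¹ * ((sW ^ 2)⁻¹ + (ω ^ 2)⁻¹)) = (sW ^ 2 - ω ^ 2) / sW ^ 4 := by
    field_simp; ring
  rw [e]
  exact div_nonneg (by nlinarith [mul_le_mul hωs hωs hω0.le hs0.le]) (by positivity)

/-- `ι_K(0) = 0`. [folklore] -/
theorem iotaK_zero {n m : ℕ} [NeZero n] [NeZero m] (hnm : n ≤ m) :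
    iotaK (d := d) n m hnm (fun _ => 0) = fun _ => 0 := by
  funext ν
  apply Fin.ext
  rw [iotaK_val, Fin.val_zero, Fin.val_zero]
  exact iota_zero (Nat.one_le_iff_ne_zero.mpr (NeZero.ne n))

/-- `Pom_N(0) = 12^d`. [folklore] -/
theorem Pom_zero (N : ℕ) [NeZero N] : Pom (d := d) N (fun _ => (0 : Fin N)) = 12 ^ d := by
  unfold Pom
  simp only [Fin.val_zero, omega_zero N (Nat.one_le_iff_ne_zero.mpr (NeZero.ne N)), div_one, Finset.prod_const,
    Finset.card_univ, Fintype.card_fin]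

/-- `ρ_0 = 1`. [folklore] -/
theorem rho_zero (N : ℕ) [NeZero N] (p : Fin d → ℂ) : B5Hk163Strip.rho N (fun _ => (0 : Fin N)) p = 1 := by
  unfold B5Hk163Strip.rho; exact if_pos rfl

/-- the tail coefficient with the `μ`-coordinate of `ūC` split off. [folklore] -/
theorem tailC_eq (N : ℕ) [NeZero N] (μ : Fin d) (K : Fin d → Fin N) (p : Fin d → ℂ) :
    tailC N μ K p = dC N K p μ * vCbar N K p μ * (∏ ν ∈ univ.erase μ, vCbar N K p ν)
      * (∑ k' ∈ univ.erase K, B5Hk163Strip.Afac N μ K k' p) / Ncal N p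
      * ((∏ ν, Yc N ν p) / (Yc N μ p * F66 N p)) := by
  unfold tailC uCbar
  rw [← Finset.mul_prod_erase univ (fun ν => vCbar N K p ν) (Finset.mem_univ μ)]
  ring

/-! #### constants of the chain -/

/-- bound of `(ΠY)/(Y_μ F)`. [folklore] -/
def BYF (d : ℕ) : ℝ := (2 * Bc d ^ 2) ^ d / (cY163 d * cF163 d)

/-- rate constant of `(ΠY)/(Y_μ F)`. [folklore] -/
def KYF (d : ℕ) : ℝ := d * (2 * Bc d ^ 2) ^ d * KY d / (cY163 d * cF163 d)
    + (2 * Bc d ^ 2) ^ d * (2 * Bc d ^ 2 * KF d + KY d * MF d) / (cY163 d * cF163 d) ^ 2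

/-- rate constant of `gdir`. [folklore] -/
def Kg (d : ℕ) : ℝ := 4 * KY d / cY163 d ^ 2

/-- `0 ≤ BYF`. [folklore] -/
theorem BYF_nonneg (d : ℕ) : 0 ≤ BYF d := by
  unfold BYF; have := Bc_pos d; have := cY163_pos d; have := cF163_pos d; positivity

/-- `0 ≤ KYF`. [folklore] -/
theorem KYF_nonneg (d : ℕ) : 0 ≤ KYF d := by
  unfold KYF
  have := Bc_pos d; have := cY163_pos d; have := cF163_pos d; have := KY_nonneg d; have := KF_nonneg d
  have := MF_pos d
  positivity

/-- `0 ≤ Kg`. [folklore] -/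
theorem Kg_nonneg (d : ℕ) : 0 ≤ Kg d := by
  unfold Kg; have := cY163_pos d; have := KY_nonneg d; positivity

/-- head bound coefficient. [folklore] -/
def BHd (d : ℕ) (βh : ℝ) : ℝ := βh / cY163 d

/-- head rate coefficient. [folklore] -/
def KHd (d : ℕ) (βh κh : ℝ) : ℝ := κh / cY163 d + βh * KY d / cY163 d ^ 2

/-- tail coefficient after `/𝒩`. [folklore] -/
def BT1 (d : ℕ) (βt : ℝ) : ℝ := βt / cN163 d

/-- tail rate coefficient after `/𝒩`. [folklore] -/
def KT1 (d : ℕ) (βt κt : ℝ) : ℝ := κt / cN163 d + βt * KNcal d / cN163 d ^ 2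

/-- tail coefficient after `·(ΠY)/(Y_μF)`. [folklore] -/
def BT2 (d : ℕ) (βt : ℝ) : ℝ := BT1 d βt * BYF d

/-- tail rate coefficient after `·(ΠY)/(Y_μF)`. [folklore] -/
def KT2 (d : ℕ) (βt κt : ℝ) : ℝ := BT1 d βt * KYF d + KT1 d βt κt * BYF d

/-- tail coefficient after `·gdir`. [folklore] -/
def BT3 (d : ℕ) (βt : ℝ) : ℝ := BT2 d βt * Mg163 d

/-- tail rate coefficient after `·gdir`. [folklore] -/
def KT3 (d : ℕ) (βt κt : ℝ) : ℝ := BT2 d βt * Kg d + KT2 d βt κt * Mg163 d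

/-- bound coefficient of `h`. [folklore] -/
def Bh163 (d : ℕ) (βh βt : ℝ) : ℝ := BHd d βh + BT3 d βt

/-- rate coefficient of `h`. [folklore] -/
def Kh163 (d : ℕ) (βh κh βt κt : ℝ) : ℝ := KHd d βh κh + KT3 d βt κt

/-- head numerator bound constant. [folklore] -/
def βH (d : ℕ) : ℝ := 12 * Bc d * (64 / 7)

/-- head numerator rate constant. [folklore] -/
def κH (d : ℕ) : ℝ := 12 * Krho d * d + Cv * Bc d * (64 / 7) * (1 + d)

/-- tail numerator bound constant. [folklore] -/
def βN (d : ℕ) : ℝ := 2 * BS d / 3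

/-- tail numerator rate constant. [folklore] -/
def κN (d : ℕ) : ℝ := 2 * KS d * d / 3 + Cv * BS d * d / 18 + Cp * BS d / 6

/-- head numerator bound constant, zero alias. [folklore] -/
def βH0 (d : ℕ) : ℝ := 12 ^ (d + 1)

/-- head numerator rate constant, zero alias. [folklore] -/
def κH0 (d : ℕ) : ℝ := 12 ^ d * Cv * (1 + d)

/-- tail numerator bound constant, zero alias. [folklore] -/
def βN0 (d : ℕ) : ℝ := 12 ^ d * BS0 d / 3

/-- tail numerator rate constant, zero alias. [folklore] -/
def κN0 (d : ℕ) : ℝ := 12 ^ d * KS0 d / 3 + Cv * 12 ^ d * d * BS0 d / 36 + Cp * 12 ^ d * BS0 d / 12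

/-- **bound constant of `h_{l;μλ}` in the profile `Pom·W⁻¹`** (`l ≠ 0`). [folklore] -/
def Bh (d : ℕ) : ℝ := Bh163 d (βH d) (βN d)

/-- **rate constant of `h_{l;μλ}`** (`l ≠ 0`). [folklore] -/
def Kh (d : ℕ) : ℝ := Kh163 d (βH d) (κH d) (βN d) (κN d)

/-- bound constant of `h_{0;μλ}`. [folklore] -/
def Bh0 (d : ℕ) : ℝ := Bh163 d (βH0 d) (βN0 d)

/-- **rate constant of `h_{0;μλ}`**. [folklore] -/
def Kh0 (d : ℕ) : ℝ := Kh163 d (βH0 d) (κH0 d) (βN0 d) (κN0 d)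

/-! #### numerator packages (fat region) -/

section Num

variable {n m : ℕ} [NeZero n] [NeZero m] (hn : 2 ≤ n) (hnm : n ≤ m) {r : ℝ} (hr : r ≤ 1 / 4)
  (hdr : (d : ℝ) * r ^ 2 ≤ 1 / 16) {p : Fin d → ℂ} (hp : p ∈ Fat d r)
include hn hnm hr hp

/-- package of `ūC(p′+l)`: bound `Pom`, rate `(Cv/n)·Pom·Σ_ν ω_ν/12`. [folklore] -/
theorem uCbar_RB (k : Fin d → Fin n) :
    RB (uCbar m (iotaK n m hnm k) p) (uCbar n k p) (Pom n k)
      (Cv / n * Pom n k * ∑ ν, (12 / omega n (k ν))⁻¹) := by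
  unfold uCbar Pom
  exact RB.prod_inv univ (fun ν _ => by have := omega_pos n (k ν) (k ν).isLt; positivity)
    (fun ν _ => vCbar_RB hn hnm hr hp k ν)

/-- package of `Π_{ν ≠ μ} v̄C_ν(p′+l)`. [folklore] -/
theorem prodErase_RB (k : Fin d → Fin n) (μ : Fin d) :
    RB (∏ ν ∈ univ.erase μ, vCbar m (iotaK n m hnm k) p ν) (∏ ν ∈ univ.erase μ, vCbar n k p ν)
      (omega n (k μ) / 12 * Pom n k)
      (Cv / n * (omega n (k μ) / 12 * Pom n k) * ∑ ν, (12 / omega n (k ν))⁻¹) := by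
  have h := RB.prod_inv (univ.erase μ) (fun ν _ => by have := omega_pos n (k ν) (k ν).isLt; positivity)
    (fun ν _ => vCbar_RB hn hnm hr hp k ν)
  rw [prod_erase_eq_Pom] at h
  have hω := omega_pos n (k μ) (k μ).isLt
  have hP := Pom_pos n k
  have hC := Cv_nonneg
  refine h.mono le_rfl (mul_le_mul_of_nonneg_left (Finset.sum_le_sum_of_subset_of_nonneg
    (Finset.erase_subset μ univ) (fun ν _ _ => by have := omega_pos n (k ν) (k ν).isLt; positivity)) ?_)
  positivity

omit [NeZero m] hn hnm hr hp in
/-- `Σ_ν ω_n(l_ν)/12 ≤ d·√W/12` (`l ≠ 0`). [folklore] -/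
theorem sum_inv_c_le_sqrtW {k : Fin d → Fin n} (hk : k ≠ fun _ => 0) :
    ∑ ν, (12 / omega n (k ν))⁻¹ ≤ d * Real.sqrt (W n k) / 12 := by
  calc ∑ ν, (12 / omega n (k ν))⁻¹ ≤ ∑ _ν : Fin d, Real.sqrt (W n k) / 12 :=
        Finset.sum_le_sum (fun ν _ => by
          rw [inv_div]; exact div_le_div_of_nonneg_right (omega_le_sqrtW n hk ν) (by norm_num))
    _ = d * Real.sqrt (W n k) / 12 := by
        rw [Finset.sum_const, Finset.card_univ, Fintype.card_fin, nsmul_eq_mul]; ring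

include hdr in
set_option maxHeartbeats 800000 in
/-- **HEAD NUMERATOR** `ūC·v̄C_μ·ρ_l` (`l ≠ 0`): bound `βH·(Pom·W⁻¹)`, rate `κH·(n⁻¹·prof)`. [folklore] -/
theorem headNum_RB {k : Fin d → Fin n} (hk : k ≠ fun _ => 0) (μ : Fin d) :
    RB (uCbar m (iotaK n m hnm k) p * vCbar m (iotaK n m hnm k) p μ * B5Hk163Strip.rho m (iotaK n m hnm k) p)
      (uCbar n k p * vCbar n k p μ * B5Hk163Strip.rho n k p)
      (βH d * (Pom n k * (W n k)⁻¹)) (κH d * (((n : ℝ))⁻¹ * prof n k)) := by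
  have h := ((uCbar_RB hn hnm hr hp k).mul (vCbar_RB hn hnm hr hp k μ)).mul (rho_RB hn hnm hr hdr hp hk)
  have hSg := sum_inv_c_le_sqrtW (n := n) hk
  have hSg0 : 0 ≤ ∑ ν, (12 / omega n (k ν))⁻¹ :=
    Finset.sum_nonneg (fun ν _ => by have := omega_pos n (k ν) (k ν).isLt; positivity)
  have hP := Pom_pos n k
  have hsW1 := one_le_sqrtW n hk
  have hωs := omega_le_sqrtW n hk μ
  have hω1 := one_le_omega n _ (k μ).isLt
  have hν := inv_level_le n hk
  have hWsq : W n k = Real.sqrt (W n k) ^ 2 := (sq_sqrtW n k).symm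
  unfold prof
  set Sg := ∑ ν, (12 / omega n (k ν))⁻¹ with hSgdef
  set P := Pom n k with hPdef
  set ω := omega n (k μ) with hωdef
  set sW := Real.sqrt (W n k) with hsWdef
  rw [hWsq] at h ⊢
  have hsW0 : 0 < sW := by linarith
  have hτ0 : 0 ≤ sW⁻¹ := by positivity
  have hτ1 : sW⁻¹ ≤ 1 := inv_le_one_of_one_le₀ hsW1
  have hσ1 : ω⁻¹ ≤ 1 := inv_le_one_of_one_le₀ hω1
  have hω0 : 0 < ω := by linarith
  have hσ0 : 0 ≤ ω⁻¹ := by positivity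
  have hν0 : 0 ≤ ((n : ℝ))⁻¹ := by positivity
  have hSgτ : Sg * sW⁻¹ ≤ d / 12 := by
    calc Sg * sW⁻¹ ≤ d * sW / 12 * sW⁻¹ := mul_le_mul_of_nonneg_right hSg hτ0
      _ = d / 12 := by field_simp
  have htt : (sW ^ 2)⁻¹ = sW⁻¹ * sW⁻¹ := by rw [sq, mul_inv]
  have hu : ((n : ℝ) ^ 2)⁻¹ = ((n : ℝ))⁻¹ * ((n : ℝ))⁻¹ := by rw [sq, mul_inv]
  have hBc := Bc_pos d; have hKr := Krho_nonneg d; have hCv := Cv_nonneg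
  have hT2 : ω⁻¹ * (Sg * sW⁻¹) ≤ d / 12 := by
    calc ω⁻¹ * (Sg * sW⁻¹) ≤ 1 * (d / 12) := mul_le_mul hσ1 hSgτ (by positivity) zero_le_one
      _ = d / 12 := one_mul _
  have hT3 : ω⁻¹ * ((n : ℝ))⁻¹ ≤ d * sW⁻¹ := by
    calc ω⁻¹ * ((n : ℝ))⁻¹ ≤ 1 * (d * sW⁻¹) := mul_le_mul hσ1 hν hν0 zero_le_one
      _ = d * sW⁻¹ := one_mul _
  refine h.mono ?_ ?_ <;> simp only [div_eq_mul_inv, htt, hu] <;>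
    generalize sW⁻¹ = τ at hτ0 hτ1 hSgτ hT2 hT3 ⊢ <;> generalize ω⁻¹ = σ at hσ0 hσ1 hT2 hT3 ⊢ <;>
    generalize ((n : ℝ))⁻¹ = ν at hν0 hT3 ⊢
  · unfold βH
    nlinarith [mul_le_mul_of_nonneg_left hσ1 (by positivity : (0 : ℝ) ≤ P * Bc d * (τ * τ))]
  · unfold κH
    nlinarith [mul_le_mul_of_nonneg_left hτ1 (by positivity : (0 : ℝ) ≤ P * Cv * ν * Bc d * τ),
      mul_le_mul_of_nonneg_left hT2 (by positivity : (0 : ℝ) ≤ Cv * ν * P * Bc d * τ),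
      mul_le_mul_of_nonneg_left hT3 (by positivity : (0 : ℝ) ≤ P * Krho d * ν)]

include hdr in
set_option maxHeartbeats 800000 in
/-- **TAIL NUMERATOR** `(∂_μ v̄C_μ)·(Π_{ν≠μ} v̄C_ν)·Σ_{l′} A_{l,l′}` (`l ≠ 0`): bound `βN·(Pom·W⁻¹)`, rate `κN·(n⁻¹·prof)`.
[folklore] -/
theorem tailNum_RB {k : Fin d → Fin n} (hk : k ≠ fun _ => 0) (μ : Fin d) :
    RB (dC m (iotaK n m hnm k) p μ * vCbar m (iotaK n m hnm k) p μ
          * (∏ ν ∈ univ.erase μ, vCbar m (iotaK n m hnm k) p ν)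
          * ∑ k' ∈ univ.erase (iotaK n m hnm k), B5Hk163Strip.Afac m μ (iotaK n m hnm k) k' p)
      (dC n k p μ * vCbar n k p μ * (∏ ν ∈ univ.erase μ, vCbar n k p ν)
          * ∑ k' ∈ univ.erase k, B5Hk163Strip.Afac n μ k k' p)
      (βN d * (Pom n k * (W n k)⁻¹)) (κN d * (((n : ℝ))⁻¹ * prof n k)) := by
  have h := ((dC_mul_vCbar_RB hn hnm hr hp k μ).mul (prodErase_RB hn hnm hr hp k μ)).mul
    (SA_RB hn hnm hr hdr hp hk μ)
  have hSg := sum_inv_c_le_sqrtW (n := n) hk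
  have hSg0 : 0 ≤ ∑ ν, (12 / omega n (k ν))⁻¹ :=
    Finset.sum_nonneg (fun ν _ => by have := omega_pos n (k ν) (k ν).isLt; positivity)
  have hP := Pom_pos n k
  have hsW1 := one_le_sqrtW n hk
  have hωs := omega_le_sqrtW n hk μ
  have hω1 := one_le_omega n _ (k μ).isLt
  have hν := inv_level_le n hk
  have hWsq : W n k = Real.sqrt (W n k) ^ 2 := (sq_sqrtW n k).symm
  unfold prof
  set Sg := ∑ ν, (12 / omega n (k ν))⁻¹ with hSgdef
  set P := Pom n k with hPdef
  set ω := omega n (k μ) with hωdef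
  set sW := Real.sqrt (W n k) with hsWdef
  rw [hWsq] at h ⊢
  have hsW0 : 0 < sW := by linarith
  have hω0 : 0 < ω := by linarith
  have hτ0 : 0 ≤ sW⁻¹ := by positivity
  have hτ1 : sW⁻¹ ≤ 1 := inv_le_one_of_one_le₀ hsW1
  have hν0 : 0 ≤ ((n : ℝ))⁻¹ := by positivity
  have ht0 : 0 ≤ (sW ^ 2)⁻¹ := by positivity
  have hs0 : 0 ≤ (ω ^ 2)⁻¹ := by positivity
  have ht1 : (sW ^ 2)⁻¹ ≤ sW⁻¹ := by
    rw [sq, mul_inv]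
    calc sW⁻¹ * sW⁻¹ ≤ sW⁻¹ * 1 := mul_le_mul_of_nonneg_left hτ1 hτ0
      _ = sW⁻¹ := mul_one _
  have hM1 := omega_mul_tt_le hω1 hωs
  have hM2 := omega_mul_ts_le hω1 hωs
  have hM3 := omega_sq_mul_tt_le hω1 hωs
  have hSgτ : Sg * sW⁻¹ ≤ d / 12 := by
    calc Sg * sW⁻¹ ≤ d * sW / 12 * sW⁻¹ := mul_le_mul_of_nonneg_right hSg hτ0
      _ = d / 12 := by field_simp
  have hSgt : Sg * (sW ^ 2)⁻¹ ≤ d / 12 * sW⁻¹ := by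
    rw [sq, mul_inv]
    calc Sg * (sW⁻¹ * sW⁻¹) = Sg * sW⁻¹ * sW⁻¹ := by ring
      _ ≤ d / 12 * sW⁻¹ := mul_le_mul_of_nonneg_right hSgτ hτ0
  have hu : ((n : ℝ) ^ 2)⁻¹ = ((n : ℝ))⁻¹ * ((n : ℝ))⁻¹ := by rw [sq, mul_inv]
  have hBS := BS_nonneg d; have hKS := KS_nonneg d; have hCv := Cv_nonneg
  have hCp : 0 ≤ Cp := by unfold Cp; positivity
  -- combined monomial facts
  have hR1 : ((n : ℝ))⁻¹ * (ω * ((sW ^ 2)⁻¹ + (ω ^ 2)⁻¹)) ≤ d * sW⁻¹ * 2 :=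
    mul_le_mul hν hM2 (by positivity) (by positivity)
  have hR2 : Sg * (ω * ((sW ^ 2)⁻¹ * ((sW ^ 2)⁻¹ + (ω ^ 2)⁻¹))) ≤ 2 * (d / 12 * sW⁻¹) := by
    calc Sg * (ω * ((sW ^ 2)⁻¹ * ((sW ^ 2)⁻¹ + (ω ^ 2)⁻¹))) ≤ Sg * (2 * (sW ^ 2)⁻¹) :=
          mul_le_mul_of_nonneg_left hM1 hSg0
      _ = 2 * (Sg * (sW ^ 2)⁻¹) := by ring
      _ ≤ 2 * (d / 12 * sW⁻¹) := by linarith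
  have hR3 : ω ^ 2 * ((sW ^ 2)⁻¹ * ((sW ^ 2)⁻¹ + (ω ^ 2)⁻¹)) ≤ 2 * sW⁻¹ := hM3.trans (by linarith)
  have hB1 : ω * ((sW ^ 2)⁻¹ * ((sW ^ 2)⁻¹ + (ω ^ 2)⁻¹)) ≤ 2 * (sW ^ 2)⁻¹ := hM1
  refine h.mono ?_ ?_ <;> simp only [div_eq_mul_inv, hu] <;>
    generalize (sW ^ 2)⁻¹ = t at ht0 ht1 hR1 hR2 hR3 hB1 ⊢ <;> generalize (ω ^ 2)⁻¹ = s at hs0 hR1 hR2 hR3 hB1 ⊢ <;>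
    generalize sW⁻¹ = τ at hτ0 hτ1 hR1 hR2 hR3 ⊢ <;> generalize ((n : ℝ))⁻¹ = ν at hν0 hR1 ⊢
  · unfold βN
    nlinarith [mul_le_mul_of_nonneg_left hB1 (by positivity : (0 : ℝ) ≤ P * BS d)]
  · unfold κN
    nlinarith [mul_le_mul_of_nonneg_left hR1 (by positivity : (0 : ℝ) ≤ KS d * P * ν),
      mul_le_mul_of_nonneg_left hR2 (by positivity : (0 : ℝ) ≤ Cv * BS d * ν * P),
      mul_le_mul_of_nonneg_left hR3 (by positivity : (0 : ℝ) ≤ Cp * BS d * ν * P)]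

/-- package of `ūC(p′)` at the zero alias. [folklore] -/
theorem uCbar0_RB :
    RB (uCbar m (fun _ => 0) p) (uCbar n (fun _ => 0) p) ((12 : ℝ) ^ d) (Cv / n * 12 ^ d * (d / 12)) := by
  have h := uCbar_RB hn hnm hr hp (fun _ => 0)
  rw [iotaK_zero] at h
  have hn1 : 1 ≤ n := by omega
  have e1 : Pom n (fun _ => (0 : Fin n)) = 12 ^ d := Pom_zero n
  have e2 : ∑ _ν : Fin d, (12 / omega n ((0 : Fin n) : ℕ))⁻¹ = d / 12 := by
    rw [Fin.val_zero, omega_zero n hn1, div_one, Finset.sum_const, Finset.card_univ, Fintype.card_fin,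
      nsmul_eq_mul]; ring
  rw [e1, e2] at h
  exact h

/-- package of `v̄C_μ(p′)` at the zero alias. [folklore] -/
theorem vCbar0_RB (μ : Fin d) :
    RB (vCbar m (fun _ => 0) p μ) (vCbar n (fun _ => 0) p μ) 12 (Cv / n) := by
  have h := vCbar_RB hn hnm hr hp (fun _ => 0) μ
  rw [iotaK_zero] at h
  have hn1 : 1 ≤ n := by omega
  have e : (12 : ℝ) / omega n ((0 : Fin n) : ℕ) = 12 := by rw [Fin.val_zero, omega_zero n hn1, div_one]
  rw [e] at h
  exact h

/-- package of `∂_μ v̄C_μ` at the zero alias. [folklore] -/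
theorem dCv0_RB (μ : Fin d) :
    RB (dC m (fun _ => 0) p μ * vCbar m (fun _ => 0) p μ) (dC n (fun _ => 0) p μ * vCbar n (fun _ => 0) p μ)
      4 (Cp / n) := by
  have h := dC_mul_vCbar_RB hn hnm hr hp (fun _ => 0) μ
  rw [iotaK_zero] at h
  have hn1 : 1 ≤ n := by omega
  have e : Cp * omega n ((0 : Fin n) : ℕ) / n = Cp / n := by rw [Fin.val_zero, omega_zero n hn1, mul_one]
  rw [e] at h
  exact h

/-- package of `Π_{ν≠μ} v̄C_ν` at the zero alias. [folklore] -/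
theorem prodErase0_RB (μ : Fin d) :
    RB (∏ ν ∈ univ.erase μ, vCbar m (fun _ => 0) p ν) (∏ ν ∈ univ.erase μ, vCbar n (fun _ => 0) p ν)
      ((12 : ℝ) ^ d / 12) (Cv / n * (12 ^ d / 12) * (d / 12)) := by
  have h := prodErase_RB hn hnm hr hp (fun _ => 0) μ
  rw [iotaK_zero] at h
  have hn1 : 1 ≤ n := by omega
  have e1 : Pom n (fun _ => (0 : Fin n)) = 12 ^ d := Pom_zero n
  have e2 : ∑ _ν : Fin d, (12 / omega n ((0 : Fin n) : ℕ))⁻¹ = d / 12 := by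
    rw [Fin.val_zero, omega_zero n hn1, div_one, Finset.sum_const, Finset.card_univ, Fintype.card_fin,
      nsmul_eq_mul]; ring
  have e3 : omega n ((0 : Fin n) : ℕ) / 12 = 1 / 12 := by rw [Fin.val_zero, omega_zero n hn1]
  rw [e1, e2, e3] at h
  refine h.mono (le_of_eq (by ring)) (le_of_eq (by ring))

/-- **HEAD NUMERATOR AT THE ZERO ALIAS**. [folklore] -/
theorem headNum0_RB (μ : Fin d) :
    RB (uCbar m (fun _ => 0) p * vCbar m (fun _ => 0) p μ * B5Hk163Strip.rho m (fun _ => 0) p)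
      (uCbar n (fun _ => 0) p * vCbar n (fun _ => 0) p μ * B5Hk163Strip.rho n (fun _ => 0) p)
      (βH0 d * 1) (κH0 d * (((n : ℝ))⁻¹ * 1)) := by
  rw [rho_zero, rho_zero]
  have h := ((uCbar0_RB hn hnm hr hp).mul (vCbar0_RB hn hnm hr hp μ)).mul RB_one
  refine h.mono (le_of_eq (by unfold βH0; ring)) (le_of_eq ?_)
  unfold κH0; simp only [div_eq_mul_inv]; ring

include hdr in
/-- **TAIL NUMERATOR AT THE ZERO ALIAS**. [folklore] -/
theorem tailNum0_RB (μ : Fin d) :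
    RB (dC m (fun _ => 0) p μ * vCbar m (fun _ => 0) p μ * (∏ ν ∈ univ.erase μ, vCbar m (fun _ => 0) p ν)
          * ∑ k' ∈ univ.erase (fun _ => (0 : Fin m)), B5Hk163Strip.Afac m μ (fun _ => 0) k' p)
      (dC n (fun _ => 0) p μ * vCbar n (fun _ => 0) p μ * (∏ ν ∈ univ.erase μ, vCbar n (fun _ => 0) p ν)
          * ∑ k' ∈ univ.erase (fun _ => (0 : Fin n)), B5Hk163Strip.Afac n μ (fun _ => 0) k' p)
      (βN0 d * 1) (κN0 d * (((n : ℝ))⁻¹ * 1)) := by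
  have h := ((dCv0_RB hn hnm hr hp μ).mul (prodErase0_RB hn hnm hr hp μ)).mul (SA0_RB hn hnm hr hdr hp μ)
  have hn1 : 1 ≤ n := by omega
  have hu : ((n : ℝ) ^ 2)⁻¹ ≤ ((n : ℝ))⁻¹ := by
    have := div_sq_le_mul_inv (show (0 : ℝ) ≤ 1 by norm_num) hn1
    simpa using this
  have hν0 : 0 ≤ ((n : ℝ))⁻¹ := by positivity
  have hBS0 : 0 ≤ BS0 d := by unfold BS0; have := Bc_pos d; positivity
  have hKS0 := KS0_nonneg d
  have hCv := Cv_nonneg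
  have hCp : 0 ≤ Cp := by unfold Cp; positivity
  refine h.mono (le_of_eq (by unfold βN0; ring)) ?_
  simp only [div_eq_mul_inv]
  generalize ((n : ℝ) ^ 2)⁻¹ = u at hu ⊢
  generalize ((n : ℝ))⁻¹ = ν at hu hν0 ⊢
  unfold κN0
  nlinarith [mul_le_mul_of_nonneg_left hu (by positivity : (0 : ℝ) ≤ 4 * (12 ^ d * 12⁻¹) * KS0 d)]

end Num

/-! #### the chain on the zero-free strip -/

section Chain

variable {n m : ℕ} [NeZero n] [NeZero m] (hn : 2 ≤ n) (hnm : n ≤ m) {κ : ℝ} (hκ0 : 0 ≤ κ)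
  (hκ : κ ≤ kappa163 d) {p : Fin d → ℂ} (hp : p ∈ Strip d κ)
include hn hnm hκ0 hκ hp

omit hn hnm hκ0 in
/-- strip points are fat points (`r = rOf d`). [folklore] -/
theorem fat_of_strip163 : p ∈ Fat d (rOf d) :=
  strip_subset_fat (rOf_pos d).le (hκ.trans (kappa163_le_rOf d)) hp

/-- package of `(Π_ν Y_ν)/(Y_μ F)`. [folklore] -/
theorem Yfrac_RB (μ : Fin d) :
    RB ((∏ ν, Yc m ν p) / (Yc m μ p * F66 m p)) ((∏ ν, Yc n ν p) / (Yc n μ p * F66 n p)) (BYF d)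
      (KYF d / (n : ℝ) ^ 2) := by
  have hq := fat_of_strip163 hκ hp
  have hr := rOf_le d
  have hdr := d_mul_rOf_sq_le d
  obtain ⟨hFm, -, hYm, -⟩ := denominators_lower m hκ0 hκ hp
  obtain ⟨hFn, -, hYn, -⟩ := denominators_lower n hκ0 hκ hp
  have hB : 1 ≤ 2 * Bc d ^ 2 := by have := one_le_Bc d; nlinarith
  have hρ : 0 ≤ KY d / (n : ℝ) ^ 2 := by have := KY_nonneg d; positivity
  have hnum := RB.prod univ hB hρ (fun ν _ => Yc_RB hn hnm hr hdr hq ν)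
  rw [Finset.card_univ, Fintype.card_fin] at hnum
  have hden := (Yc_RB hn hnm hr hdr hq μ).mul (F66_RB hn hnm hr hdr hq)
  have hc : 0 < cY163 d * cF163 d := mul_pos (cY163_pos d) (cF163_pos d)
  have hlm : cY163 d * cF163 d ≤ ‖Yc m μ p * F66 m p‖ := by
    rw [norm_mul]; exact mul_le_mul (hYm μ) hFm (cF163_pos d).le (norm_nonneg _)
  have hln : cY163 d * cF163 d ≤ ‖Yc n μ p * F66 n p‖ := by
    rw [norm_mul]; exact mul_le_mul (hYn μ) hFn (cF163_pos d).le (norm_nonneg _)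
  have h := RB_div hc hnum hden hlm hln
  refine h.mono (by unfold BYF; exact le_rfl) (le_of_eq ?_)
  unfold KYF; simp only [div_eq_mul_inv]; ring

/-- package of `gdir_λ = (1 − e^{−ip′_λ})/Y_λ` (same numerator at both levels). [folklore] -/
theorem gdir_RB (lam : Fin d) : RB (gdir m lam p) (gdir n lam p) (Mg163 d) (Kg d / (n : ℝ) ^ 2) := by
  have hq := fat_of_strip163 hκ hp
  have hr := rOf_le d
  have hdr := d_mul_rOf_sq_le d
  obtain ⟨-, -, hYm, -⟩ := denominators_lower m hκ0 hκ hp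
  obtain ⟨-, -, hYn, -⟩ := denominators_lower n hκ0 hκ hp
  refine ⟨norm_gdir_le m hκ0 hκ hp lam, norm_gdir_le n hκ0 hκ hp lam, ?_⟩
  have hκ1 : κ ≤ 1 := (hκ.trans (kappa163_le_rOf d)).trans ((rOf_le d).trans (by norm_num))
  have hE : ‖expFacNeg lam p‖ ≤ 4 := by
    refine (norm_expFac_le hp lam).1.trans ?_
    have h1 : Real.exp κ ≤ Real.exp 1 := Real.exp_le_exp.mpr hκ1
    have h2 := Real.exp_one_lt_d9
    linarith
  have hY := (Yc_RB hn hnm hr hdr hq lam).sub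
  have hc := cY163_pos d
  unfold cY163 at hc
  have hm0 : Yc m lam p ≠ 0 := fun h => by
    have := hYm lam; rw [h, norm_zero] at this; linarith
  have hn0 : Yc n lam p ≠ 0 := fun h => by
    have := hYn lam; rw [h, norm_zero] at this; linarith
  unfold gdir
  have e : expFacNeg lam p / Yc m lam p - expFacNeg lam p / Yc n lam p
      = expFacNeg lam p * (Yc n lam p - Yc m lam p) / (Yc m lam p * Yc n lam p) := by
    rw [div_sub_div _ _ hm0 hn0]; congr 1; ring
  rw [e]
  refine (norm_div_le_of (A := 4 * (KY d / (n : ℝ) ^ 2)) ?_ (mul_pos (cY163_pos d) (cY163_pos d)) ?_).trans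
    (le_of_eq ?_)
  · rw [norm_mul]
    exact mul_le_mul hE (by rw [norm_sub_rev]; exact hY) (norm_nonneg _) (by norm_num)
  · rw [norm_mul]; exact mul_le_mul (hYm lam) (hYn lam) (cY163_pos d).le (norm_nonneg _)
  · unfold Kg; simp only [div_eq_mul_inv, sq, mul_inv]; try ring

/-- **THE CHAIN** `numerator packages ⟹ package of h_{l;μλ}`: head `/Y_μ`, tail `/𝒩 · (ΠY)/(Y_μF) · gdir_λ`, then
`δ_{λμ}·head + tail·gdir`. Currency `(β·Y, κ·(n⁻¹·X))`, `0 ≤ Y ≤ X`. [folklore] -/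
theorem h163_RB_of {K : Fin d → Fin m} {k : Fin d → Fin n} {X Y βh κh βt κt : ℝ} (hY : 0 ≤ Y) (hYX : Y ≤ X)
    (hβh : 0 ≤ βh) (hβt : 0 ≤ βt) (μ lam : Fin d)
    (hhead : RB (uCbar m K p * vCbar m K p μ * B5Hk163Strip.rho m K p)
      (uCbar n k p * vCbar n k p μ * B5Hk163Strip.rho n k p) (βh * Y) (κh * (((n : ℝ))⁻¹ * X)))
    (htail : RB (dC m K p μ * vCbar m K p μ * (∏ ν ∈ univ.erase μ, vCbar m K p ν)
          * ∑ k' ∈ univ.erase K, B5Hk163Strip.Afac m μ K k' p)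
      (dC n k p μ * vCbar n k p μ * (∏ ν ∈ univ.erase μ, vCbar n k p ν)
          * ∑ k' ∈ univ.erase k, B5Hk163Strip.Afac n μ k k' p) (βt * Y) (κt * (((n : ℝ))⁻¹ * X))) :
    RB (h163 m μ lam K p) (h163 n μ lam k p) (Bh163 d βh βt * Y)
      (Kh163 d βh κh βt κt * (((n : ℝ))⁻¹ * X)) := by
  have hq := fat_of_strip163 hκ hp
  have hr := rOf_le d
  have hdr := d_mul_rOf_sq_le d
  obtain ⟨-, hNm, hYm, -⟩ := denominators_lower m hκ0 hκ hp
  obtain ⟨-, hNn, hYn, -⟩ := denominators_lower n hκ0 hκ hp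
  have hn1 : 1 ≤ n := by omega
  have hν0 : 0 ≤ ((n : ℝ))⁻¹ := by positivity
  have hH : RB (headC m μ K p) (headC n μ k p) (BHd d βh * Y) (KHd d βh κh * (((n : ℝ))⁻¹ * X)) := by
    unfold headC BHd KHd
    exact RB_ndiv (cY163_pos d) hhead (Yc_RB hn hnm hr hdr hq μ) (div_sq_le_mul_inv (KY_nonneg d) hn1)
      (hYm μ) (hYn μ) hY hYX hβh
  have hT1 := RB_ndiv (cN163_pos d) htail (Ncal_RB hn hnm hr hdr hq) (div_sq_le_mul_inv (KNcal_nonneg d) hn1)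
      hNm hNn hY hYX hβt
  have hBT1 : 0 ≤ BT1 d βt := div_nonneg hβt (cN163_pos d).le
  have hT2 : RB (tailC m μ K p) (tailC n μ k p) (BT2 d βt * Y) (KT2 d βt κt * (((n : ℝ))⁻¹ * X)) := by
    rw [tailC_eq, tailC_eq]
    unfold BT2 KT2 BT1 KT1
    exact RB_nmul hT1 (Yfrac_RB hn hnm hκ0 hκ hp μ) (div_sq_le_mul_inv (KYF_nonneg d) hn1) hY hYX hBT1
  have hBT2 : 0 ≤ BT2 d βt := mul_nonneg hBT1 (BYF_nonneg d)
  have hT3 : RB (tailC m μ K p * gdir m lam p) (tailC n μ k p * gdir n lam p) (BT3 d βt * Y)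
      (KT3 d βt κt * (((n : ℝ))⁻¹ * X)) := by
    unfold BT3 KT3
    exact RB_nmul hT2 (gdir_RB hn hnm hκ0 hκ hp lam) (div_sq_le_mul_inv (Kg_nonneg d) hn1) hY hYX hBT2
  have hI : RB (if lam = μ then headC m μ K p else 0) (if lam = μ then headC n μ k p else 0) (BHd d βh * Y)
      (KHd d βh κh * (((n : ℝ))⁻¹ * X)) := by
    split_ifs
    · exact hH
    · exact ⟨by rw [norm_zero]; exact hH.B_nonneg, by rw [norm_zero]; exact hH.B_nonneg,
        by rw [sub_zero, norm_zero]; exact hH.ρ_nonneg⟩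
  unfold h163 Bh163 Kh163
  exact (hI.add hT3).mono (le_of_eq (by ring)) (le_of_eq (by ring))

omit hn hnm hκ0 hκ hp in
/-- `0 ≤ Bh163`. [folklore] -/
theorem Bh163_nonneg {βh βt : ℝ} (hβh : 0 ≤ βh) (hβt : 0 ≤ βt) : 0 ≤ Bh163 d βh βt := by
  unfold Bh163 BHd BT3 BT2 BT1 Mg163
  have := cY163_pos d; have := cN163_pos d; have := BYF_nonneg d
  positivity

/-- **PACKAGE OF `h_{l;μλ}` AT A PAIRED ALIAS** `l = ι l₀`, `l₀ ≠ 0`: bound `Bh·Pom·W⁻¹`, rate `Kh·n⁻¹·prof`.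
[folklore] -/
theorem h163_RB {k : Fin d → Fin n} (hk : k ≠ fun _ => 0) (μ lam : Fin d) :
    RB (h163 m μ lam (iotaK n m hnm k) p) (h163 n μ lam k p) (Bh d * (Pom n k * (W n k)⁻¹))
      (Kh d * (((n : ℝ))⁻¹ * prof n k)) := by
  have hq := fat_of_strip163 hκ hp
  have hr := rOf_le d
  have hdr := d_mul_rOf_sq_le d
  have hW := one_le_W n k hk
  have hs1 := one_le_sqrtW n hk
  have hP := Pom_pos n k
  have hY : 0 ≤ Pom n k * (W n k)⁻¹ := by positivity
  have hYX : Pom n k * (W n k)⁻¹ ≤ prof n k := by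
    unfold prof
    refine mul_le_mul_of_nonneg_left (inv_anti₀ (by positivity) ?_) hP.le
    calc Real.sqrt (W n k) ≤ Real.sqrt (W n k) * Real.sqrt (W n k) := le_mul_of_one_le_right (by positivity) hs1
      _ = W n k := Real.mul_self_sqrt (W_nonneg n k)
  have hβh : 0 ≤ βH d := by unfold βH; have := Bc_pos d; positivity
  have hβt : 0 ≤ βN d := by unfold βN; have := BS_nonneg d; positivity
  exact h163_RB_of hn hnm hκ0 hκ hp hY hYX hβh hβt μ lam (headNum_RB hn hnm hr hdr hq hk μ)
    (tailNum_RB hn hnm hr hdr hq hk μ)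

/-- **PACKAGE OF `h_{0;μλ}`**: bound `Bh0`, rate `Kh0·n⁻¹`. [folklore] -/
theorem h163_zero_RB (μ lam : Fin d) :
    RB (h163 m μ lam (fun _ => 0) p) (h163 n μ lam (fun _ => 0) p) (Bh0 d * 1) (Kh0 d * (((n : ℝ))⁻¹ * 1)) := by
  have hq := fat_of_strip163 hκ hp
  have hr := rOf_le d
  have hdr := d_mul_rOf_sq_le d
  have hβh : 0 ≤ βH0 d := by unfold βH0; positivity
  have hβt : 0 ≤ βN0 d := by unfold βN0 BS0; have := Bc_pos d; positivity
  exact h163_RB_of hn hnm hκ0 hκ hp zero_le_one le_rfl hβh hβt μ lam (headNum0_RB hn hnm hr hq μ)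
    (tailNum0_RB hn hnm hr hdr hq μ)

/-- **η-RATE OF `h_{l;μλ}` AT A PAIRED ALIAS** (`l₀ ≠ 0`), with the summable profile `prof`. [folklore] -/
theorem h163_rate_ne {k : Fin d → Fin n} (hk : k ≠ fun _ => 0) (μ lam : Fin d) :
    ‖h163 m μ lam (iotaK n m hnm k) p - h163 n μ lam k p‖ ≤ Kh d * (((n : ℝ))⁻¹ * prof n k) :=
  (h163_RB hn hnm hκ0 hκ hp hk μ lam).sub

/-- **η-RATE OF `h_{0;μλ}`**. [folklore] -/
theorem h163_rate_zero (μ lam : Fin d) :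
    ‖h163 m μ lam (fun _ => 0) p - h163 n μ lam (fun _ => 0) p‖ ≤ Kh0 d * ((n : ℝ))⁻¹ := by
  have h := (h163_zero_RB hn hnm hκ0 hκ hp μ lam).sub
  simpa only [mul_one] using h

end Chain

/-- **UNIFORM PROFILE BOUND** `‖h_{l;μλ}‖ ≤ Bh·Pom_N(l)·W_N(l)⁻¹` at every level `N ≥ 2`, `l ≠ 0` (the trivial
pairing `N = N`). [folklore] -/
theorem norm_h163_le_W {N : ℕ} [NeZero N] (hN : 2 ≤ N) {κ : ℝ} (hκ0 : 0 ≤ κ) (hκ : κ ≤ kappa163 d)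
    {p : Fin d → ℂ} (hp : p ∈ Strip d κ) {K : Fin d → Fin N} (hK : K ≠ fun _ => 0) (μ lam : Fin d) :
    ‖h163 N μ lam K p‖ ≤ Bh d * (Pom N K * (W N K)⁻¹) :=
  (h163_RB hN le_rfl hκ0 hκ hp hK μ lam).right

/-- uniform bound at the zero alias, `N ≥ 2`. [folklore] -/
theorem norm_h163_zero_le {N : ℕ} [NeZero N] (hN : 2 ≤ N) {κ : ℝ} (hκ0 : 0 ≤ κ) (hκ : κ ≤ kappa163 d)
    {p : Fin d → ℂ} (hp : p ∈ Strip d κ) (μ lam : Fin d) :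
    ‖h163 N μ lam (fun _ => 0) p‖ ≤ Bh0 d := by
  have h := (h163_zero_RB hN le_rfl hκ0 hκ hp μ lam).right
  simpa only [mul_one] using h


/-! ## §4. The η-rate of the fine-offset multipliers `G_a` on the zero-free strip -/

section G

open Literature.MathematicalPhysics.QuantumFieldTheory.Balaban1983to89.B5Hk163Alias (Msum163)
open Literature.MathematicalPhysics.QuantumFieldTheory.Balaban1983to89.B5Hk163Decay (Msum163_nonneg)

/-- `0 ≤ Kh163` for non-negative data. [folklore] -/
theorem Kh163_nonneg {βh κh βt κt : ℝ} (hβh : 0 ≤ βh) (hκh : 0 ≤ κh) (hβt : 0 ≤ βt) (hκt : 0 ≤ κt) :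
    0 ≤ Kh163 d βh κh βt κt := by
  unfold Kh163 KHd KT3 KT2 KT1 BT2 BT1 Mg163
  have := cY163_pos d; have := cN163_pos d; have := BYF_nonneg d; have := KYF_nonneg d; have := Kg_nonneg d
  have := KY_nonneg d; have := KNcal_nonneg d
  positivity

/-- `0 ≤ Bh`. [folklore] -/
theorem Bh_nonneg (d : ℕ) : 0 ≤ Bh d :=
  Bh163_nonneg (by unfold βH; have := Bc_pos d; positivity) (by unfold βN; have := BS_nonneg d; positivity)

/-- `0 ≤ Bh0`. [folklore] -/
theorem Bh0_nonneg (d : ℕ) : 0 ≤ Bh0 d :=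
  Bh163_nonneg (by unfold βH0; positivity) (by unfold βN0 BS0; have := Bc_pos d; positivity)

/-- `0 ≤ Kh`. [folklore] -/
theorem Kh_nonneg (d : ℕ) : 0 ≤ Kh d := by
  have := Bc_pos d; have := BS_nonneg d; have := KS_nonneg d; have := Krho_nonneg d; have := Cv_nonneg
  have hCp : 0 ≤ Cp := by unfold Cp; positivity
  exact Kh163_nonneg (by unfold βH; positivity) (by unfold κH; positivity) (by unfold βN; positivity)
    (by unfold κN; positivity)

/-- `0 ≤ Kh0`. [folklore] -/
theorem Kh0_nonneg (d : ℕ) : 0 ≤ Kh0 d := by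
  have := Bc_pos d; have := KS0_nonneg d; have := Cv_nonneg
  have hCp : 0 ≤ Cp := by unfold Cp; positivity
  have hBS0 : 0 ≤ BS0 d := by unfold BS0; positivity
  exact Kh163_nonneg (by unfold βH0; positivity) (by unfold κH0; positivity) (by unfold βN0; positivity)
    (by unfold κN0; positivity)

/-- the rate constant of `G_a` for `n ≥ 2`. [folklore] -/
def CG2 (d : ℕ) : ℝ := Kh0 d + (Kh d + 2 * Bh d) * Cprof d

/-- **the rate constant of `G_a`** (all `n ≥ 1`). [folklore] -/
def CG (d : ℕ) : ℝ := CG2 d + 2 * Msum163 d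

/-- `0 ≤ CG2`. [folklore] -/
theorem CG2_nonneg (d : ℕ) : 0 ≤ CG2 d := by
  unfold CG2; have := Kh0_nonneg d; have := Kh_nonneg d; have := Bh_nonneg d; have := Cprof_nonneg d
  positivity

/-- `0 ≤ CG`. [folklore] -/
theorem CG_nonneg (d : ℕ) : 0 ≤ CG d := by
  unfold CG; have := CG2_nonneg d; have := Msum163_nonneg d; positivity

variable {n m : ℕ} [NeZero n] [NeZero m]

/-- **η-RATE OF `G_a` ON THE ZERO-FREE STRIP, `n ≥ 2`**: for `n ≤ m`, fine offsets `a` (level `n`) and `a′` (level `m`)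
at the SAME PHYSICAL POSITION (`a′/m = a/n`), `‖G_{a′}^{(m)}(p′) − G_a^{(n)}(p′)‖ ≤ (e^κ)^d·CG2(d)/n`. [folklore] -/
theorem G163_rate_two (hn : 2 ≤ n) (hnm : n ≤ m) {κ : ℝ} (hκ0 : 0 ≤ κ) (hκ : κ ≤ kappa163 d) {p : Fin d → ℂ}
    (hp : p ∈ Strip d κ) (μ lam : Fin d) (a : Fin d → Fin n) (a' : Fin d → Fin m)
    (hphys : ∀ ν, (a' ν : ℕ) * n = (a ν : ℕ) * m) :
    ‖G163 m μ lam a' p - G163 n μ lam a p‖ ≤ Real.exp κ ^ d * CG2 d / n := by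
  classical
  have hn1 : 1 ≤ n := by omega
  have hm2 : 2 ≤ m := hn.trans hnm
  have hE0 : 0 ≤ Real.exp κ ^ d := by positivity
  have hν0 : 0 ≤ ((n : ℝ))⁻¹ := by positivity
  have hKh := Kh_nonneg d; have hKh0 := Kh0_nonneg d; have hBh := Bh_nonneg d
  have hph : ∀ k : Fin d → Fin n, phase163 m (iotaK n m hnm k) a' p = phase163 n k a p :=
    fun k => phase163_iotaK_eq hnm k a a' hphys p
  have hph0 : phase163 m (fun _ => 0) a' p = phase163 n (fun _ => 0) a p := by
    have := hph (fun _ => 0); rwa [iotaK_zero] at this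
  unfold G163
  rw [← Finset.add_sum_erase univ _ (Finset.mem_univ (fun _ => (0 : Fin m))),
    ← Finset.add_sum_erase univ _ (Finset.mem_univ (fun _ => (0 : Fin n))),
    ← Finset.sum_filter_add_sum_filter_not (univ.erase (fun _ => (0 : Fin m)))
      (fun k' => ∀ ν, Paired n m (k' ν)),
    filter_paired_eq_image hnm, Finset.sum_image (fun k₁ _ k₂ _ h => iotaK_injective hnm h)]
  simp_rw [hph]
  rw [hph0]
  set φ0 := phase163 n (fun _ => (0 : Fin n)) a p with hφ0
  set SPm := ∑ k ∈ univ.erase (fun _ => (0 : Fin n)), phase163 n k a p * h163 m μ lam (iotaK n m hnm k) p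
    with hSPm
  set SPn := ∑ k ∈ univ.erase (fun _ => (0 : Fin n)), phase163 n k a p * h163 n μ lam k p with hSPn
  set SU := ∑ k' ∈ (univ.erase (fun _ => (0 : Fin m))).filter (fun k' => ¬ ∀ ν, Paired n m (k' ν)),
    phase163 m k' a' p * h163 m μ lam k' p with hSU
  have e : φ0 * h163 m μ lam (fun _ => 0) p + (SPm + SU) - (φ0 * h163 n μ lam (fun _ => 0) p + SPn)
      = φ0 * (h163 m μ lam (fun _ => 0) p - h163 n μ lam (fun _ => 0) p) + (SPm - SPn) + SU := by ring
  rw [e]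
  -- the three pieces
  have T0 : ‖φ0 * (h163 m μ lam (fun _ => 0) p - h163 n μ lam (fun _ => 0) p)‖
      ≤ Real.exp κ ^ d * (Kh0 d * ((n : ℝ))⁻¹) := by
    rw [norm_mul]
    exact mul_le_mul (norm_phase163_le n hp _ a) (h163_rate_zero hn hnm hκ0 hκ hp μ lam) (norm_nonneg _) hE0
  have TP : ‖SPm - SPn‖ ≤ Real.exp κ ^ d * (Kh d * ((n : ℝ))⁻¹) * Cprof d := by
    have e1 : SPm - SPn = ∑ k ∈ univ.erase (fun _ => (0 : Fin n)),
        phase163 n k a p * (h163 m μ lam (iotaK n m hnm k) p - h163 n μ lam k p) := by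
      rw [hSPm, hSPn, ← Finset.sum_sub_distrib]
      exact Finset.sum_congr rfl (fun k _ => by ring)
    rw [e1]
    calc ‖∑ k ∈ univ.erase (fun _ => (0 : Fin n)),
            phase163 n k a p * (h163 m μ lam (iotaK n m hnm k) p - h163 n μ lam k p)‖
        ≤ ∑ k ∈ univ.erase (fun _ => (0 : Fin n)),
            ‖phase163 n k a p * (h163 m μ lam (iotaK n m hnm k) p - h163 n μ lam k p)‖ := norm_sum_le _ _
      _ ≤ ∑ k ∈ univ.erase (fun _ => (0 : Fin n)), Real.exp κ ^ d * (Kh d * (((n : ℝ))⁻¹ * prof n k)) :=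
          Finset.sum_le_sum (fun k hk => by
            rw [norm_mul]
            exact mul_le_mul (norm_phase163_le n hp k a)
              (h163_rate_ne hn hnm hκ0 hκ hp (Finset.mem_erase.mp hk).1 μ lam) (norm_nonneg _) hE0)
      _ = Real.exp κ ^ d * (Kh d * ((n : ℝ))⁻¹) * ∑ k ∈ univ.erase (fun _ => (0 : Fin n)), prof n k := by
          rw [Finset.mul_sum]; exact Finset.sum_congr rfl (fun k _ => by ring)
      _ ≤ Real.exp κ ^ d * (Kh d * ((n : ℝ))⁻¹) * Cprof d :=
          mul_le_mul_of_nonneg_left ((Finset.sum_le_sum_of_subset_of_nonneg (Finset.erase_subset _ _)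
            (fun K _ _ => prof_nonneg n K)).trans (sum_prof_le n)) (by positivity)
  have TU : ‖SU‖ ≤ Real.exp κ ^ d * (Bh d * (2 / n)) * Cprof d := by
    calc ‖SU‖ ≤ ∑ k' ∈ (univ.erase (fun _ => (0 : Fin m))).filter (fun k' => ¬ ∀ ν, Paired n m (k' ν)),
            ‖phase163 m k' a' p * h163 m μ lam k' p‖ := norm_sum_le _ _
      _ ≤ ∑ k' ∈ (univ.erase (fun _ => (0 : Fin m))).filter (fun k' => ¬ ∀ ν, Paired n m (k' ν)),
            Real.exp κ ^ d * (Bh d * (2 / n) * prof m k') := by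
          refine Finset.sum_le_sum (fun K hK => ?_)
          rw [Finset.mem_filter, Finset.mem_erase] at hK
          have hK0 : K ≠ fun _ => 0 := hK.1.1
          rw [norm_mul]
          refine mul_le_mul (norm_phase163_le m hp K a') ?_ (norm_nonneg _) hE0
          refine (norm_h163_le_W hm2 hκ0 hκ hp hK0 μ lam).trans ?_
          unfold prof
          calc Bh d * (Pom m K * (W m K)⁻¹) ≤ Bh d * (Pom m K * (2 / n * (Real.sqrt (W m K))⁻¹)) :=
                mul_le_mul_of_nonneg_left (mul_le_mul_of_nonneg_left (inv_W_unpaired_le hn1 hK0 hK.2)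
                  (Pom_pos m K).le) hBh
            _ = Bh d * (2 / n) * (Pom m K * (Real.sqrt (W m K))⁻¹) := by ring
      _ = Real.exp κ ^ d * (Bh d * (2 / n)) *
            ∑ k' ∈ (univ.erase (fun _ => (0 : Fin m))).filter (fun k' => ¬ ∀ ν, Paired n m (k' ν)), prof m k' := by
          rw [Finset.mul_sum]; exact Finset.sum_congr rfl (fun k _ => by ring)
      _ ≤ Real.exp κ ^ d * (Bh d * (2 / n)) * Cprof d :=
          mul_le_mul_of_nonneg_left ((Finset.sum_le_sum_of_subset_of_nonneg (Finset.subset_univ _)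
            (fun K _ _ => prof_nonneg m K)).trans (sum_prof_le m)) (by positivity)
  calc ‖φ0 * (h163 m μ lam (fun _ => 0) p - h163 n μ lam (fun _ => 0) p) + (SPm - SPn) + SU‖
      ≤ ‖φ0 * (h163 m μ lam (fun _ => 0) p - h163 n μ lam (fun _ => 0) p)‖ + ‖SPm - SPn‖ + ‖SU‖ :=
        norm_add₃_le
    _ ≤ Real.exp κ ^ d * (Kh0 d * ((n : ℝ))⁻¹) + Real.exp κ ^ d * (Kh d * ((n : ℝ))⁻¹) * Cprof d
          + Real.exp κ ^ d * (Bh d * (2 / n)) * Cprof d := add_le_add_three T0 TP TU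
    _ = Real.exp κ ^ d * CG2 d / n := by unfold CG2; rw [div_eq_mul_inv, div_eq_mul_inv]; ring

/-- **η-RATE OF `G_a` ON THE ZERO-FREE STRIP** (every `1 ≤ n ≤ m`, same physical fine offset):
`‖G_{a′}^{(m)}(p′) − G_a^{(n)}(p′)‖ ≤ (e^κ)^d·CG(d)/n`. [folklore] -/
theorem G163_rate (hn : 1 ≤ n) (hnm : n ≤ m) {κ : ℝ} (hκ0 : 0 ≤ κ) (hκ : κ ≤ kappa163 d) {p : Fin d → ℂ}
    (hp : p ∈ Strip d κ) (μ lam : Fin d) (a : Fin d → Fin n) (a' : Fin d → Fin m)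
    (hphys : ∀ ν, (a' ν : ℕ) * n = (a ν : ℕ) * m) :
    ‖G163 m μ lam a' p - G163 n μ lam a p‖ ≤ Real.exp κ ^ d * CG d / n := by
  have hE0 : 0 ≤ Real.exp κ ^ d := by positivity
  have hM := Msum163_nonneg d
  have hC2 := CG2_nonneg d
  have hn0 : (0 : ℝ) < n := by exact_mod_cast (by omega : 0 < n)
  rcases (show n = 1 ∨ 2 ≤ n by omega) with h1 | h2
  · subst h1
    calc ‖G163 m μ lam a' p - G163 1 μ lam a p‖ ≤ ‖G163 m μ lam a' p‖ + ‖G163 1 μ lam a p‖ := norm_sub_le _ _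
      _ ≤ Real.exp κ ^ d * Msum163 d + Real.exp κ ^ d * Msum163 d :=
          add_le_add (norm_G163_le m hκ0 hκ hp μ lam a') (norm_G163_le 1 hκ0 hκ hp μ lam a)
      _ ≤ Real.exp κ ^ d * CG d / (1 : ℕ) := by
          rw [Nat.cast_one, div_one]; unfold CG; nlinarith [mul_nonneg hE0 hC2]
  · refine (G163_rate_two h2 hnm hκ0 hκ hp μ lam a a' hphys).trans ?_
    unfold CG
    refine div_le_div_of_nonneg_right (mul_le_mul_of_nonneg_left (by linarith) hE0) hn0.le

end G

/-! ## §5. Position space: strip regularity of the level difference and the kernel rates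

Dimension `d + 1` (the b04 engine is stated on `ℂ^{d+1}`), width `0 ≤ κ ≤ κ₁₆₃(d+1)`. -/

section Position

open Literature.MathematicalPhysics.QuantumFieldTheory.Balaban1983to89.B4ContourShift (StripRegular latticeKernel
  latticeKernel_decay supNorm)
open Literature.MathematicalPhysics.QuantumFieldTheory.Balaban1983to89.B4Green242Bridge (latticeKernel_sub)
open Literature.MathematicalPhysics.QuantumFieldTheory.Balaban1983to89.T4GaugeActionRateStrip (torusKernel_descendC_sub)
open Literature.MathematicalPhysics.QuantumFieldTheory.Balaban1983to89.B4TorusKernel (descendC periodConst)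
open Literature.MathematicalPhysics.QuantumFieldTheory.Balaban1983to89.B4TorusKernel.MultiPeriod
  (torusKernel torusSupNorm torusKernel_descend_decay_torusMetric)

/-- the explicit `d`-only position-space rate constant `(e¹)^d · CG d`. [folklore] -/
def CGe (d : ℕ) : ℝ := Real.exp 1 ^ d * CG d

/-- `0 ≤ CGe`. [folklore] -/
theorem CGe_nonneg (d : ℕ) : 0 ≤ CGe d := by unfold CGe; have := CG_nonneg d; positivity

variable {n m : ℕ} [NeZero n] [NeZero m]

/-- **STRIP REGULARITY OF THE LEVEL DIFFERENCE** `G_{a′}^{(m)} − G_a^{(n)}` on `Strip (d+1) κ`, `0 ≤ κ ≤ κ₁₆₃(d+1)`,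
with bound THE RATE `CGe(d+1)/n`. [folklore] -/
theorem stripRegular_G163_sub (hn : 1 ≤ n) (hnm : n ≤ m) {κ : ℝ} (hκ0 : 0 ≤ κ) (hκ : κ ≤ kappa163 (d + 1))
    (μ lam : Fin (d + 1)) (a : Fin (d + 1) → Fin n) (a' : Fin (d + 1) → Fin m)
    (hphys : ∀ ν, (a' ν : ℕ) * n = (a ν : ℕ) * m) :
    StripRegular (d := d) (fun p => G163 m μ lam a' p - G163 n μ lam a p) κ (CGe (d + 1) / n) := by
  have h₂ := stripRegular_G163 (d := d) m hκ0 hκ μ lam a'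
  have h₁ := stripRegular_G163 (d := d) n hκ0 hκ μ lam a
  have hκ1 : κ ≤ 1 := (hκ.trans (kappa163_le_rOf (d + 1))).trans ((rOf_le (d + 1)).trans (by norm_num))
  refine ⟨h₂.cont.sub h₁.cont, fun i q hq => (h₂.diff i q hq).sub (h₁.diff i q hq), ?_, ?_⟩
  · intro i q hq y hy
    show G163 m μ lam a' _ - G163 n μ lam a _ = G163 m μ lam a' _ - G163 n μ lam a _
    rw [h₂.sides i q hq y hy, h₁.sides i q hq y hy]
  · intro p hp
    refine (G163_rate hn hnm hκ0 hκ hp μ lam a a' hphys).trans ?_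
    unfold CGe
    have hC := CG_nonneg (d + 1)
    have he : Real.exp κ ^ (d + 1) ≤ Real.exp 1 ^ (d + 1) :=
      pow_le_pow_left₀ (Real.exp_pos κ).le (Real.exp_le_exp.mpr hκ1) _
    exact div_le_div_of_nonneg_right (mul_le_mul_of_nonneg_right he hC) (Nat.cast_nonneg n)

/-- **η-RATE OF THE INFINITE-LATTICE KERNELS** of `G_a` (`B4ContourShift.latticeKernel_decay` BY NAME): for
`1 ≤ n ≤ m`, the same physical fine offset, every `x ∈ ℤ^{d+1}`:
`‖K_{a′}^{(m)}(x) − K_a^{(n)}(x)‖ ≤ CGe(d+1)/n · e^{−κ₁₆₃(d+1)|x|_∞}`. [folklore] -/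
theorem latticeKernel_G163_rate (hn : 1 ≤ n) (hnm : n ≤ m) (μ lam : Fin (d + 1)) (a : Fin (d + 1) → Fin n)
    (a' : Fin (d + 1) → Fin m) (hphys : ∀ ν, (a' ν : ℕ) * n = (a ν : ℕ) * m) (x : Fin (d + 1) → ℤ) :
    ‖latticeKernel (fun p : Fin (d + 1) → ℂ => G163 m μ lam a' p) x
        - latticeKernel (fun p : Fin (d + 1) → ℂ => G163 n μ lam a p) x‖
      ≤ CGe (d + 1) / n * Real.exp (-(kappa163 (d + 1) * supNorm x)) := by
  have hκ0 : 0 ≤ kappa163 (d + 1) := (kappa163_pos (d + 1)).le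
  have I₁ := (stripRegular_G163 (d := d) n hκ0 le_rfl μ lam a).integrableOn hκ0 x
  have I₂ := (stripRegular_G163 (d := d) m hκ0 le_rfl μ lam a').integrableOn hκ0 x
  rw [← latticeKernel_sub x I₂ I₁]
  exact latticeKernel_decay (stripRegular_G163_sub hn hnm hκ0 le_rfl μ lam a a' hphys) hκ0 x

/-- **η-RATE OF THE TORUS KERNELS** of `G_a` (`B4TorusKernel.MultiPeriod.torusKernel_descend_decay_torusMetric` BY
NAME), UNIFORMLY IN THE VOLUME: every period vector `N` (all `N_i ≥ 1`), `1 ≤ n ≤ m`, same physical fine offset, `x`: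
`‖K_{a′,N}^{(m)}(x) − K_{a,N}^{(n)}(x)‖ ≤ CGe(d+1)/n · periodConst(κ₁₆₃(d+1), d) · e^{−(κ₁₆₃(d+1)/(d+1))·|x|_{T,∞}}`.
[folklore] -/
theorem torusKernel_G163_rate (hn : 1 ≤ n) (hnm : n ≤ m) (μ lam : Fin (d + 1)) (a : Fin (d + 1) → Fin n)
    (a' : Fin (d + 1) → Fin m) (hphys : ∀ ν, (a' ν : ℕ) * n = (a ν : ℕ) * m) {N : Fin (d + 1) → ℕ}
    (hN : ∀ i, 1 ≤ N i) (x : Fin (d + 1) → ℤ) :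
    ‖torusKernel (descendC (fun p : Fin (d + 1) → ℂ => G163 m μ lam a' p)
          (stripRegular_G163 m (kappa163_pos _).le le_rfl μ lam a') (kappa163_pos _).le) N x
        - torusKernel (descendC (fun p : Fin (d + 1) → ℂ => G163 n μ lam a p)
          (stripRegular_G163 n (kappa163_pos _).le le_rfl μ lam a) (kappa163_pos _).le) N x‖ ≤
      CGe (d + 1) / n * periodConst (kappa163 (d + 1)) d *
        Real.exp (-(kappa163 (d + 1) / (d + 1) * torusSupNorm N x)) := by
  have hκ0 : 0 < kappa163 (d + 1) := kappa163_pos (d + 1)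
  rw [torusKernel_descendC_sub (stripRegular_G163 n hκ0.le le_rfl μ lam a)
    (stripRegular_G163 m hκ0.le le_rfl μ lam a') (stripRegular_G163_sub hn hnm hκ0.le le_rfl μ lam a a' hphys)
    hκ0.le N x]
  exact torusKernel_descend_decay_torusMetric _ hκ0 hN x

/-- KING'S SHAPE `n = L^k`, `m = L^{k+j}` (fine offsets `a` and `a′ = a·L^j` componentwise): amplitude
`CGe(d+1)·L^{−k}` on `ℤ^{d+1}`. [folklore] -/
theorem latticeKernel_G163_rate_king (L k j : ℕ) [NeZero L] (μ lam : Fin (d + 1))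
    (a : Fin (d + 1) → Fin (L ^ k)) (a' : Fin (d + 1) → Fin (L ^ (k + j)))
    (hphys : ∀ ν, (a' ν : ℕ) * L ^ k = (a ν : ℕ) * L ^ (k + j)) (x : Fin (d + 1) → ℤ) :
    ‖latticeKernel (fun p : Fin (d + 1) → ℂ => G163 (L ^ (k + j)) μ lam a' p) x
        - latticeKernel (fun p : Fin (d + 1) → ℂ => G163 (L ^ k) μ lam a p) x‖
      ≤ CGe (d + 1) / (L : ℝ) ^ k * Real.exp (-(kappa163 (d + 1) * supNorm x)) := by
  have hL : 1 ≤ L := Nat.one_le_iff_ne_zero.mpr (NeZero.ne L)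
  have h := latticeKernel_G163_rate (d := d) (n := L ^ k) (m := L ^ (k + j)) (Nat.one_le_pow _ _ hL)
    (Nat.pow_le_pow_right hL (by omega)) μ lam a a' hphys x
  simpa using h

/-- KING'S SHAPE on every torus. [folklore] -/
theorem torusKernel_G163_rate_king (L k j : ℕ) [NeZero L] (μ lam : Fin (d + 1))
    (a : Fin (d + 1) → Fin (L ^ k)) (a' : Fin (d + 1) → Fin (L ^ (k + j)))
    (hphys : ∀ ν, (a' ν : ℕ) * L ^ k = (a ν : ℕ) * L ^ (k + j)) {N : Fin (d + 1) → ℕ} (hN : ∀ i, 1 ≤ N i)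
    (x : Fin (d + 1) → ℤ) :
    ‖torusKernel (descendC (fun p : Fin (d + 1) → ℂ => G163 (L ^ (k + j)) μ lam a' p)
          (stripRegular_G163 (L ^ (k + j)) (kappa163_pos _).le le_rfl μ lam a') (kappa163_pos _).le) N x
        - torusKernel (descendC (fun p : Fin (d + 1) → ℂ => G163 (L ^ k) μ lam a p)
          (stripRegular_G163 (L ^ k) (kappa163_pos _).le le_rfl μ lam a) (kappa163_pos _).le) N x‖ ≤
      CGe (d + 1) / (L : ℝ) ^ k * periodConst (kappa163 (d + 1)) d *
        Real.exp (-(kappa163 (d + 1) / (d + 1) * torusSupNorm N x)) := by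
  have hL : 1 ≤ L := Nat.one_le_iff_ne_zero.mpr (NeZero.ne L)
  have h := torusKernel_G163_rate (d := d) (n := L ^ k) (m := L ^ (k + j)) (Nat.one_le_pow _ _ hL)
    (Nat.pow_le_pow_right hL (by omega)) μ lam a a' hphys hN x
  simpa using h

end Position

end

end Literature.MathematicalPhysics.QuantumFieldTheory.Balaban1983to89.T4Hk163StripRate
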